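import Literature.MathematicalPhysics.QuantumFieldTheory.Z2FiniteTemperatureDeconfinement
import Literature.MathematicalPhysics.QuantumFieldTheory.ZnCentreDominatedWilsonLoopsAllN
import HarnessLib

/-!
# Abelian-centre domination of the finite-temperature Polyakov-loop two-point function
# (Fröhlich 1979 / Grosse 1988 (4.131)–(4.134) on the lattice `ℤ_{L₀} × (ℤ/L)^d` of Borgs–Seiler):
# `|G_L^{G,ρ}(x; J_E, J_M)| ≤ N² · G_L^{Γ}(x; N J_E, N J_M)` and the transfer of Polyakov
# confinement / long-range order between a gauge theory and its abelian centre

Statement-and-proof file (topic `Literature/MathematicalPhysics/QuantumFieldTheory`), everything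
PROVED, no named facts, in the ASYMMETRIC finite-temperature vocabulary of the barrier file
`Literature.Barriers.QuantumFields.FiniteTemperatureDeconfinement` (Borgs–Seiler 1983 §II.3: the
periodic lattice `ℤ_{L₀} × (ℤ/L)^d`, `FiniteTemperature.Config`, Wilson's action with electric and
magnetic couplings `J_E, J_M` (`minusAction`), `expectation`, the Polyakov loop `polyakovLine`, its
trace `polyakovTrace`, the two-point function `polyakovCorrelation ρ J_E J_M x = Re⟨χ(g_{L_0}) χ̄(g_{L_x})⟩`
((II.22)), thermodynamic limits `IsThermodynamicLimit`, Polyakov's criterion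
`HasPolyakovLongRangeOrder` / `PolyakovConfinementAtAllCouplings` / `UniformClusteringAtAllCouplings`)
— the companion of `AbelianCentreDominatedPolyakovLoops.lean` (symmetric torus, one coupling `β`),
resolving its `TODO(general form)`.

## Main results (everything PROVED; 0 named facts)

Setting (Fröhlich 1979; Grosse 1988 §4.2.4): `G` compact second countable, `ρ : G →* M_N(ℂ)`
continuous with unitary values, `Γ` compact second-countable abelian, `φ : Γ → U(1)` a continuous
character, `ι : Γ → Z(G)` continuous with `ρ(ι(γ)) = φ(γ)·1`; either every element of `Γ` is a square
(`U(1)`, `ℤ_n` odd: Messager–Miracle-Solé–Pfister + Ginibre, tree's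
`abs_phasedGinibreExpect_re_mul_le_of_le`) or `Γ = ℤ_n`, any `n ≥ 1` (Ginibre's square-root
extension `ℤ_n^E ↪ ℤ_{2n}^E`, tree's `GinibreSqrtExt.abs_phasedGinibreExpect_re_mul_le_of_le_of_sqrtExt`);
the comparison theory is the `Γ` theory in the one-dimensional representation `charRep φ`
(`= u1Rep` for `Γ = U(1)`, `= znRep n` for `Γ = ℤ_n`) on the SAME lattice with couplings `(N J_E, N J_M)`.

* `ThermalCentre.twist`, `plaquette_twist`, `polyakovLine_twist`, `polyakovTrace_twist`,
  `minusAction_twist`, `weight_twist` (Grosse (4.131)–(4.133) on `ℤ_{L₀} × (ℤ/L)^d`: in the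
  background `U` the twisted weight is the phased Ginibre weight of the `Γ` theory with couplings
  `J_{E/M}|tr ρ(U_P)| ≤ N J_{E/M}` and phases `arg tr ρ(U_P)`), `measurePreserving_twist`,
  `integral_eq_integral_integral_twist` (averaged Haar invariance);
* `ThermalCentre.expectation_charRep_eq_ginibreExpect`: the `Γ` theory is a Ginibre model;
* `ThermalCentre.abs_expectation_le_of_twist` (`…_zn`): ABSTRACT DOMINATION of every continuous
  twist-covariant observable `X(ι(σ)U) = M⁻¹ Re(t(U) χ₀(σ))`, `‖t‖ ≤ M`:
  `|⟨X⟩_{G,ρ,J_E,J_M}| ≤ ⟨Re χ₀⟩_{Γ, charRep φ, N J_E, N J_M}`;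
* ★ `abs_polyakovCorrelation_le_abelianCentre` (`Γ` with surjective squaring) and
  ★ `abs_polyakovCorrelation_le_zn_of_neZero` (`Γ = ℤ_n`, every `n`): for `J_E, J_M ≥ 0`, every
  temporal extent `L₀`, spatial box `L` and `x`,
  `|G_L^{G,ρ}(x; J_E, J_M)| ≤ N² · G_L^{Γ}(x; N J_E, N J_M)`, and the complex-kernel form
  `‖K_L^{G,ρ}(0, x)‖ ≤ N² · G_L^{Γ}(x; N J_E, N J_M)` (`norm_polyakovKernel_le_abelianCentre`);
* TRANSFERS along Polyakov's criterion (Borgs–Seiler (II.23)), `N ≥ 1`: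
  `hasPolyakovLongRangeOrder_of_dominated` / `polyakovConfinementAtAllCouplings_of_dominated` /
  `uniformClusteringAtAllCouplings_of_dominated` (abstract: any finite-volume domination
  `|G^ρ| ≤ C · G^{ρ'}` transports long-range order DOWN to `ρ'` and confinement UP to `ρ`, via a
  sub-subsequence of the thermodynamic limit) and their centre instances
  `hasPolyakovLongRangeOrder_abelianCentre` (LRO of `G` at `(J_E,J_M)` ⇒ LRO of `Γ` at
  `(N J_E, N J_M)`), `polyakovConfinementAtAllCouplings_of_abelianCentre`,
  `uniformClusteringAtAllCouplings_of_abelianCentre` (confinement of `Γ` at all couplings ⇒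
  confinement of `G` at all couplings, at the same temporal extent), `…_zn_of_neZero` versions;
* instances: `unitaryGroup_abs_polyakovCorrelation_le_u1` (`U(N) ⊇ U(1)`),
  `specialUnitaryGroup_abs_polyakovCorrelation_le_zn_of_neZero` (`SU(N) ⊇ ℤ_n`, any `n ∣ N`),
  `suN_abs_polyakovCorrelation_le_zN` (full centre, every `N ≥ 1`), `su3_abs_polyakovCorrelation_le_z3`
  (`|G^{SU(3)}_L(x;J_E,J_M)| ≤ 9 G^{ℤ_3}_L(x; 3J_E, 3J_M)`), and the corresponding transfers
  (`unitaryGroup_hasPolyakovLongRangeOrder_u1`, `suN_polyakovConfinementAtAllCouplings_of_zN`, …).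

## Status of the citation — HONEST LABEL

Fröhlich's comparison is printed for Wilson loops «for any closed curve `C`» (Grosse 1988
(4.133)–(4.134); Fröhlich 1979; for `U(N) ⊇ U(1)` Chatterjee 2026 §3); the Polyakov loops of
Borgs–Seiler's lattice are closed curves and the anisotropic couplings `(J_E, J_M)` enter only
through the bound `J|tr ρ(U_P)| ≤ NJ` plaquette by plaquette — an elementary consequence, not
located separately in print (presearch 2026-08-28: corpus hybrid + galaxy). HONEST FRAMING:
inequalities between finite-volume lattice expectations and their consequences for Polyakov's
criterion; they transfer CONFINEMENT of static quarks FROM the abelian theory (content at strong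
coupling: `U(1)` and `ℤ_n` deconfine at weak coupling / high temperature — e.g. the tree's
`z2_finiteTemperatureDeconfinement`) and DECONFINEMENT TO it; nothing here bears on the mass gap,
the continuum limit or the infrared problem; the Yang–Mills mass gap (Clay) is NOT proved; the
cell's route R4 closes only the conditional finite-`𝕋⁴` rung `BalabanLadder.UV`.

## References

* H. Grosse, *Models in Statistical Physics and Quantum Field Theory* (Springer 1988), §4.2.4
  (4.129)–(4.134). [Grosse1988]
* J. Fröhlich, Phys. Lett. 83B (1979) 195–198. [Frohlich1979ZN]
* C. Borgs, E. Seiler, Comm. Math. Phys. 91 (1983) 329–380, §II.3 (II.20)–(II.23). [BorgsSeiler1983]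
* A. Messager, S. Miracle-Solé, C. Pfister, Comm. Math. Phys. 58 (1978) 19–29, Prop. 1.
  [MessagerMiracleSolePfister1978]
* J. Ginibre, Comm. Math. Phys. 16 (1970) 310–328. [Ginibre1970]
* E. T. Tomboulis, L. G. Yaffe, Comm. Math. Phys. 100 (1985) 313–341, §II (2.8). [TomboulisYaffe1985]
-/

noncomputable section

open MeasureTheory Filter Finset Complex
open scoped ComplexConjugate Topology
open Literature.Probability.LatticeModels Literature.MathematicalPhysics.QuantumLattice
open Literature.Barriers.QuantumFields Literature.Barriers.QuantumFields.FiniteTemperature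

namespace Literature.MathematicalPhysics.QuantumFieldTheory

namespace ThermalCentre

open Z2Thermal (PlaqIdx cpl)

variable {d L₀ L N : ℕ}

/-! ### §1 Functoriality of plaquettes and Polyakov lines; the abelian twist -/

section Algebra

variable {G : Type*} [Group G]

/-- `(f∘V)_P = f(V_P)` for a homomorphism `f` applied linkwise. [folklore] -/
private theorem plaquette_mapHom {H F : Type*} [Group H] [FunLike F H G] [MonoidHomClass F H G]
    (f : F) (V : Config d L₀ L H) (x : FiniteTemperature.Site d L₀ L) (μ ν : Dir d) :
    plaquette (fun e => f (V e)) x μ ν = f (plaquette V x μ ν) := by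
  simp only [plaquette, map_mul, map_inv]

/-- `hol(f∘V) = f(hol V)` for time-like holonomies. [folklore] -/
private theorem timeHolonomy_mapHom {H F : Type*} [Group H] [FunLike F H G] [MonoidHomClass F H G]
    (f : F) (V : Config d L₀ L H) : ∀ (n : ℕ) (y : FiniteTemperature.Site d L₀ L),
    timeHolonomy (fun e => f (V e)) n y = f (timeHolonomy V n y)
  | 0, _ => by simp [timeHolonomy]
  | n + 1, y => by
      show f (V (y, none)) * timeHolonomy (fun e => f (V e)) n (y.shift none) =
        f (V (y, none) * timeHolonomy V n (y.shift none))
      rw [timeHolonomy_mapHom f V n, map_mul]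

/-- `P_x(f∘V) = f(P_x(V))` for Polyakov lines. [folklore] -/
private theorem polyakovLine_mapHom {H F : Type*} [Group H] [FunLike F H G] [MonoidHomClass F H G]
    (f : F) (V : Config d L₀ L H) (x : Fin d → ZMod L) :
    polyakovLine (fun e => f (V e)) x = f (polyakovLine V x) :=
  timeHolonomy_mapHom f V L₀ _

/-- `(f∘V)_P = f(V_P)`, `MonoidHom.compLeft` form. [folklore] -/
private theorem plaquette_compLeft {H : Type*} [Group H] (f : H →* G) (V : Config d L₀ L H)
    (x : FiniteTemperature.Site d L₀ L) (μ ν : Dir d) :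
    plaquette (MonoidHom.compLeft f (FiniteTemperature.Site d L₀ L × Dir d) V) x μ ν =
      f (plaquette V x μ ν) :=
  plaquette_mapHom f V x μ ν

/-- `P_x(f∘V) = f(P_x(V))`, `MonoidHom.compLeft` form. [folklore] -/
private theorem polyakovLine_compLeft {H : Type*} [Group H] (f : H →* G) (V : Config d L₀ L H)
    (x : Fin d → ZMod L) :
    polyakovLine (MonoidHom.compLeft f (FiniteTemperature.Site d L₀ L × Dir d) V) x =
      f (polyakovLine V x) :=
  polyakovLine_mapHom f V x

/-- `hol(1) = 1`. [folklore] -/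
private theorem timeHolonomy_one : ∀ (n : ℕ) (y : FiniteTemperature.Site d L₀ L),
    timeHolonomy (1 : Config d L₀ L G) n y = 1
  | 0, _ => rfl
  | n + 1, y => by
      show (1 : Config d L₀ L G) (y, none) * timeHolonomy (1 : Config d L₀ L G) n (y.shift none) = 1
      rw [timeHolonomy_one n, Pi.one_apply, one_mul]

variable {Γ : Type*} [CommGroup Γ] (ι : Γ →* G)

/-- The twist of a configuration by a `Γ`-valued link field `σ` through `ι : Γ → G` (into the
centre in the applications): `(ι(σ)·U)_e = ι(σ_e) U_e` — Grosse's substitution `g_b ↦ γ_b g_b`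
((4.131)) on the finite-temperature lattice. [cite: Grosse1988, §4.2.4 eq. (4.131)] -/
def twist (σ : Config d L₀ L Γ) (U : Config d L₀ L G) : Config d L₀ L G := fun e => ι (σ e) * U e

/-- Twisting by `σ⁻¹` undoes the twist by `σ`. [cite: Grosse1988, §4.2.4 eq. (4.131)] -/
theorem twist_inv_twist (σ : Config d L₀ L Γ) (U : Config d L₀ L G) :
    twist ι σ⁻¹ (twist ι σ U) = U := by
  funext e; simp [twist, map_inv, inv_mul_cancel_left]

/-- Twisting by `σ` undoes the twist by `σ⁻¹`. [cite: Grosse1988, §4.2.4 eq. (4.131)] -/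
theorem twist_twist_inv (σ : Config d L₀ L Γ) (U : Config d L₀ L G) :
    twist ι σ (twist ι σ⁻¹ U) = U := by
  funext e; simp [twist, map_inv, mul_inv_cancel_left]

/-- For central `ι` the map `(γ, g) ↦ ι(γ) g` is a homomorphism `Γ × G → G`. [folklore] -/
private def twistHom (hι : ∀ γ, ι γ ∈ Subgroup.center G) : Γ × G →* G where
  toFun p := ι p.1 * p.2
  map_one' := by simp
  map_mul' p q := by
    have hq : ∀ g : G, g * ι q.1 = ι q.1 * g := fun g => Subgroup.mem_center_iff.1 (hι q.1) g
    simp only [Prod.fst_mul, Prod.snd_mul, map_mul]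
    rw [mul_assoc, mul_assoc, ← mul_assoc (ι q.1), ← hq p.2]
    simp only [mul_assoc]

/-- **Plaquettes under a central abelian twist**: `(ι(σ)U)_P = ι(σ_P) · U_P` (Grosse (4.132):
`γ̃_∂P = ∏_{b∈∂P} γ_b`). [cite: Grosse1988, §4.2.4 eq. (4.132)] -/
theorem plaquette_twist (hι : ∀ γ, ι γ ∈ Subgroup.center G) (σ : Config d L₀ L Γ)
    (U : Config d L₀ L G) (x : FiniteTemperature.Site d L₀ L) (μ ν : Dir d) :
    plaquette (twist ι σ U) x μ ν = ι (plaquette σ x μ ν) * plaquette U x μ ν := by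
  have h := plaquette_mapHom (twistHom ι hι) (fun e => (σ e, U e)) x μ ν
  have h1 : (plaquette (fun e => (σ e, U e)) x μ ν).1 = plaquette σ x μ ν :=
    (plaquette_mapHom (MonoidHom.fst Γ G) (fun e => (σ e, U e)) x μ ν).symm
  have h2 : (plaquette (fun e => (σ e, U e)) x μ ν).2 = plaquette U x μ ν :=
    (plaquette_mapHom (MonoidHom.snd Γ G) (fun e => (σ e, U e)) x μ ν).symm
  calc plaquette (twist ι σ U) x μ ν
      = plaquette (fun e => twistHom ι hι (σ e, U e)) x μ ν := rfl
    _ = twistHom ι hι (plaquette (fun e => (σ e, U e)) x μ ν) := h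
    _ = ι (plaquette σ x μ ν) * plaquette U x μ ν := by rw [← h1, ← h2]; rfl

/-- **Time-like holonomies under a central abelian twist**: `hol(ι(σ)U) = ι(hol σ) · hol U`
(Grosse (4.133): `χ(g_C) = χ(g̃_C) ∏_{b∈C} γ_b`). [cite: Grosse1988, §4.2.4 eq. (4.133)] -/
theorem timeHolonomy_twist (hι : ∀ γ, ι γ ∈ Subgroup.center G) (σ : Config d L₀ L Γ)
    (U : Config d L₀ L G) (n : ℕ) (y : FiniteTemperature.Site d L₀ L) :
    timeHolonomy (twist ι σ U) n y = ι (timeHolonomy σ n y) * timeHolonomy U n y := by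
  have h := timeHolonomy_mapHom (twistHom ι hι) (fun e => (σ e, U e)) n y
  have h1 : (timeHolonomy (fun e => (σ e, U e)) n y).1 = timeHolonomy σ n y :=
    (timeHolonomy_mapHom (MonoidHom.fst Γ G) (fun e => (σ e, U e)) n y).symm
  have h2 : (timeHolonomy (fun e => (σ e, U e)) n y).2 = timeHolonomy U n y :=
    (timeHolonomy_mapHom (MonoidHom.snd Γ G) (fun e => (σ e, U e)) n y).symm
  calc timeHolonomy (twist ι σ U) n y
      = timeHolonomy (fun e => twistHom ι hι (σ e, U e)) n y := rfl
    _ = twistHom ι hι (timeHolonomy (fun e => (σ e, U e)) n y) := h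
    _ = ι (timeHolonomy σ n y) * timeHolonomy U n y := by rw [← h1, ← h2]; rfl

/-- **Polyakov lines under a central abelian twist**: `g_{L_x}(ι(σ)U) = ι(g_{L_x}(σ)) · g_{L_x}(U)`.
[cite: Grosse1988, §4.2.4 eq. (4.133)] -/
theorem polyakovLine_twist (hι : ∀ γ, ι γ ∈ Subgroup.center G) (σ : Config d L₀ L Γ)
    (U : Config d L₀ L G) (x : Fin d → ZMod L) :
    polyakovLine (twist ι σ U) x = ι (polyakovLine σ x) * polyakovLine U x :=
  timeHolonomy_twist ι hι σ U L₀ _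

variable (ρ : G →* Matrix (Fin N) (Fin N) ℂ) [TopologicalSpace Γ] (φ : Γ →ₜ* Circle)
variable {ρ ι φ}

/-- **The traced Polyakov loop picks up the character of the twist**: for `ρ(ι(γ)) = φ(γ)·1`,
`χ(g_{L_x}(ι(σ)U)) = φ(g_{L_x}(σ)) · χ(g_{L_x}(U))` (Grosse (4.133)). [cite: Grosse1988, §4.2.4 eq. (4.133)] -/
theorem polyakovTrace_twist (hι : ∀ γ, ι γ ∈ Subgroup.center G)
    (hρι : ∀ γ, ρ (ι γ) = ((φ γ : Circle) : ℂ) • (1 : Matrix (Fin N) (Fin N) ℂ))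
    (σ : Config d L₀ L Γ) (U : Config d L₀ L G) (x : Fin d → ZMod L) :
    polyakovTrace ρ (twist ι σ U) x = ((φ (polyakovLine σ x) : Circle) : ℂ) * polyakovTrace ρ U x := by
  rw [polyakovTrace, polyakovTrace, polyakovLine_twist ι hι, map_mul, hρι, Matrix.smul_mul, one_mul,
    Matrix.trace_smul, smul_eq_mul]

end Algebra

/-! ### §2 The characters of the abelian theory on `ℤ_{L₀} × (ℤ/L)^d` -/

section Characters

variable {Γ : Type*} [CommGroup Γ] [TopologicalSpace Γ] [IsTopologicalGroup Γ] (φ : Γ →ₜ* Circle)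

omit [TopologicalSpace Γ] [IsTopologicalGroup Γ] in
/-- In an abelian group every element is central. [folklore] -/
private theorem mem_center_of_comm (γ : Γ) : γ ∈ Subgroup.center Γ :=
  Subgroup.mem_center_iff.2 fun g => mul_comm g γ

/-- The plaquette character `σ ↦ φ(σ_P)` of the torus `Γ` theory in the representation `φ`
(the characters `χ_Γ(γ̃_∂P)` of Grosse (4.132)). [cite: Grosse1988, §4.2.4 eq. (4.132)] -/
def plaqChar (x : FiniteTemperature.Site d L₀ L) (μ ν : Dir d) : Config d L₀ L Γ →ₜ* Circle where
  toFun σ := φ (plaquette σ x μ ν)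
  map_one' := by simp [plaquette]
  map_mul' σ τ := by
    rw [← map_mul φ]
    exact congrArg φ (plaquette_twist (MonoidHom.id Γ) (mem_center_of_comm) σ τ x μ ν)
  continuous_toFun := (map_continuous φ).comp (continuous_plaquette x μ ν)

/-- `plaqChar φ x μ ν σ = φ(σ_P)`. [cite: Grosse1988, §4.2.4 eq. (4.132)] -/
@[simp] theorem plaqChar_apply (x : FiniteTemperature.Site d L₀ L) (μ ν : Dir d) (σ : Config d L₀ L Γ) :
    plaqChar φ x μ ν σ = φ (plaquette σ x μ ν) := rfl

/-- The plaquette `(base point; directions)` carried by a coupling index: time-like `(x; time, i)`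
or space-like `(x; i, j)`, `i < j`. [folklore] -/
def idxPlaq : PlaqIdx d L₀ L → FiniteTemperature.Site d L₀ L × Dir d × Dir d := fun a =>
  Sum.elim (fun q => (q.1, none, some q.2)) (fun q => (q.1, some q.2.1.1, some q.2.1.2)) a

variable (d L₀ L) in
/-- The interaction characters of the torus `Γ` theory: one plaquette character per coupling index
(time-like and space-like plaquettes). [cite: Grosse1988, §4.2.4 eq. (4.132)] -/
def plaqChars : PlaqIdx d L₀ L → (Config d L₀ L Γ →ₜ* Circle) := fun a =>
  plaqChar φ (idxPlaq a).1 (idxPlaq a).2.1 (idxPlaq a).2.2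

/-- The **Polyakov-line character** `σ ↦ φ(g_{L_x}(σ))` of the torus `Γ` theory (the abelian
Polyakov loop of Borgs–Seiler (II.22) in the representation `φ`). [cite: BorgsSeiler1983, §II.3 Lemma II.4, Remark 1 (p. 336)] -/
def lineChar (x : Fin d → ZMod L) : Config d L₀ L Γ →ₜ* Circle where
  toFun σ := φ (polyakovLine σ x)
  map_one' := by
    rw [show polyakovLine (1 : Config d L₀ L Γ) x = 1 from timeHolonomy_one L₀ _, map_one]
  map_mul' σ τ := by
    rw [← map_mul φ]
    exact congrArg φ (polyakovLine_twist (MonoidHom.id Γ) (mem_center_of_comm) σ τ x)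
  continuous_toFun := (map_continuous φ).comp (continuous_timeHolonomy L₀ _)

/-- `lineChar φ x σ = φ(g_{L_x}(σ))`. [cite: BorgsSeiler1983, §II.3 Lemma II.4 (p. 336)] -/
@[simp] theorem lineChar_apply (x : Fin d → ZMod L) (σ : Config d L₀ L Γ) :
    lineChar φ x σ = φ (polyakovLine σ x) := rfl

/-- The **Polyakov-pair character** `χ_x(σ) = φ(g_{L_0}(σ)) · φ(g_{L_x}(σ))⁻¹` — the character
through which the two-point observable `Re χ(g_{L_0}) χ̄(g_{L_x})` transforms under central twists.
[cite: BorgsSeiler1983, §II.3 (II.22) (p. 337)] [cite: Grosse1988, §4.2.4 eq. (4.133)] -/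
def pairChar (x : Fin d → ZMod L) : Config d L₀ L Γ →ₜ* Circle := lineChar φ 0 * (lineChar φ x)⁻¹

/-- In `ℂ`: `χ_x(σ) = φ(g_{L_0}(σ)) · conj φ(g_{L_x}(σ))`. [cite: BorgsSeiler1983, §II.3 (II.22) (p. 337)] -/
theorem coe_pairChar (x : Fin d → ZMod L) (σ : Config d L₀ L Γ) :
    ((pairChar φ x σ : Circle) : ℂ) =
      ((φ (polyakovLine σ 0) : Circle) : ℂ) * conj ((φ (polyakovLine σ x) : Circle) : ℂ) := by
  change (((lineChar φ 0 σ * (lineChar φ x σ)⁻¹ : Circle)) : ℂ) = _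
  rw [Circle.coe_mul, Circle.coe_inv_eq_conj, lineChar_apply, lineChar_apply]

omit [IsTopologicalGroup Γ] in
/-- `tr charRep φ (γ) = φ(γ)` (a `1 × 1` matrix). [cite: Grosse1988, §4.2.4 eq. (4.134)] -/
private theorem trace_charRep' (γ : Γ) : (charRep φ γ).trace = ((φ γ : Circle) : ℂ) := by
  rw [charRep_apply, u1Rep_apply, Matrix.scalar_apply, Matrix.trace_diagonal]
  simp

/-- **The comparison observable is the abelian Polyakov correlator**:
`Re χ_x(σ) = Re χ(g_{L_0}(σ)) χ̄(g_{L_x}(σ))` in the representation `charRep φ`.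
[cite: BorgsSeiler1983, §II.3 (II.22) (p. 337)] -/
theorem reChar_pairChar (x : Fin d → ZMod L) (σ : Config d L₀ L Γ) :
    reChar (pairChar φ x) σ =
      (polyakovTrace (charRep φ) σ 0 * conj (polyakovTrace (charRep φ) σ x)).re := by
  rw [reChar, coe_pairChar, polyakovTrace, polyakovTrace, trace_charRep', trace_charRep']

end Characters

/-! ### §3 The background system: couplings `J|tr ρ(U_P)|`, phases `arg tr ρ(U_P)` -/

section Background

variable {G : Type*} [Group G] (ρ : G →* Matrix (Fin N) (Fin N) ℂ)

/-- The plaquette trace `tr ρ(U_P)` of a coupling index. [cite: BorgsSeiler1983, §II.3 (II.20) (pp. 335–336)] -/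
def trPlaq (U : Config d L₀ L G) (a : PlaqIdx d L₀ L) : ℂ :=
  (ρ (plaquette U (idxPlaq a).1 (idxPlaq a).2.1 (idxPlaq a).2.2)).trace

/-- **Wilson's finite-temperature action as a single sum over coupling indices**:
`-S = ∑_a J_a Re tr ρ(U_a)`, `J_a ∈ {J_E, J_M}`. [cite: BorgsSeiler1983, §II.3 (II.20) (pp. 335–336)] -/
theorem minusAction_eq_sum [NeZero L₀] [NeZero L] (JE JM : ℝ) (U : Config d L₀ L G) :
    minusAction ρ JE JM U = ∑ a : PlaqIdx d L₀ L, cpl JE JM a * (trPlaq ρ U a).re := by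
  rw [minusAction, Fintype.sum_sum_type]
  simp only [cpl, trPlaq, idxPlaq, Sum.elim_inl, Sum.elim_inr, Fintype.sum_prod_type, Finset.mul_sum]

/-- The fluctuating couplings `J_a(U) = J_{E/M} |tr ρ(U_a)|` of the `Γ` system in the background `U`
(Grosse (4.133): the moduli of the complex couplings `β χ(g̃_∂P)`). [cite: Grosse1988, §4.2.4 eq. (4.133)] -/
def bgCpl (JE JM : ℝ) (U : Config d L₀ L G) (a : PlaqIdx d L₀ L) : ℝ :=
  cpl JE JM a * ‖trPlaq ρ U a‖

/-- The phases `arg tr ρ(U_a)` of the complex couplings (Grosse (4.133)). [cite: Grosse1988, §4.2.4 eq. (4.133)] -/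
def bgPh (U : Config d L₀ L G) (a : PlaqIdx d L₀ L) : Circle :=
  Circle.exp (Complex.arg (trPlaq ρ U a))

omit [Group G] in
/-- `J_E, J_M ≥ 0 ⇒ cpl ≥ 0`. [cite: BorgsSeiler1983, §II.3 (II.20) (pp. 335–336)] -/
private theorem cpl_nonneg' {JE JM : ℝ} (hJE : 0 ≤ JE) (hJM : 0 ≤ JM) (a : PlaqIdx d L₀ L) :
    0 ≤ cpl JE JM a := by
  rcases a with a | a <;> simp [cpl, hJE, hJM]

omit [Group G] in
/-- `cpl (N J_E) (N J_M) = N · cpl J_E J_M`. [cite: BorgsSeiler1983, §II.3 (II.20) (pp. 335–336)] -/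
private theorem cpl_mul (c JE JM : ℝ) (a : PlaqIdx d L₀ L) :
    cpl (c * JE) (c * JM) a = c * cpl JE JM a := by
  rcases a with a | a <;> simp [cpl]

/-- The background couplings are ferromagnetic for `J_E, J_M ≥ 0`. [cite: Grosse1988, §4.2.4 eq. (4.133)] -/
theorem bgCpl_nonneg {JE JM : ℝ} (hJE : 0 ≤ JE) (hJM : 0 ≤ JM) (U : Config d L₀ L G)
    (a : PlaqIdx d L₀ L) : 0 ≤ bgCpl ρ JE JM U a :=
  mul_nonneg (cpl_nonneg' hJE hJM a) (norm_nonneg _)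

/-- The background couplings are bounded by `(N J_E, N J_M)` for unitary `ρ` (Grosse: «replacing all
expressions `χ(g̃_∂P)` by» their bound). [cite: Grosse1988, §4.2.4 eq. (4.134)] -/
theorem bgCpl_le (hρu : ∀ g, ρ g ∈ Matrix.unitaryGroup (Fin N) ℂ) {JE JM : ℝ} (hJE : 0 ≤ JE)
    (hJM : 0 ≤ JM) (U : Config d L₀ L G) (a : PlaqIdx d L₀ L) :
    bgCpl ρ JE JM U a ≤ cpl ((N : ℝ) * JE) ((N : ℝ) * JM) a := by
  rw [bgCpl, cpl_mul, mul_comm (N : ℝ)]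
  exact mul_le_mul_of_nonneg_left (FiniteTemperature.norm_trace_le_of_mem_unitaryGroup (hρu _))
    (cpl_nonneg' hJE hJM a)

/-- Polar form of the complex coupling against a character value:
`J‖t‖ Re(e^{i arg t} z) = J Re(t z)`. [cite: Grosse1988, §4.2.4 eq. (4.133)] -/
private theorem bgCpl_mul_rePhased (JE JM : ℝ) (U : Config d L₀ L G) (a : PlaqIdx d L₀ L)
    {Ω : Type*} [CommGroup Ω] [TopologicalSpace Ω] (χ : Ω →ₜ* Circle) (θ : Ω) :
    bgCpl ρ JE JM U a * rePhased (bgPh ρ U a) χ θ =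
      cpl JE JM a * (trPlaq ρ U a * ((χ θ : Circle) : ℂ)).re := by
  set t : ℂ := trPlaq ρ U a
  have ht : (‖t‖ : ℂ) * ((bgPh ρ U a : Circle) : ℂ) = t := by
    rw [bgPh, Circle.coe_exp]; exact_mod_cast Complex.norm_mul_exp_arg_mul_I t
  rw [bgCpl, rePhased, mul_assoc, ← Complex.re_ofReal_mul, ← mul_assoc, ht]

variable {Γ : Type*} [CommGroup Γ] {ι : Γ →* G} [TopologicalSpace Γ] [IsTopologicalGroup Γ]
  {φ : Γ →ₜ* Circle} {ρ}

/-- Plaquette traces under the twist: `tr ρ((ι(σ)U)_a) = φ(σ_a) tr ρ(U_a)`. [cite: Grosse1988, §4.2.4 eq. (4.133)] -/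
theorem trPlaq_twist (hι : ∀ γ, ι γ ∈ Subgroup.center G)
    (hρι : ∀ γ, ρ (ι γ) = ((φ γ : Circle) : ℂ) • (1 : Matrix (Fin N) (Fin N) ℂ))
    (σ : Config d L₀ L Γ) (U : Config d L₀ L G) (a : PlaqIdx d L₀ L) :
    trPlaq ρ (twist ι σ U) a = ((plaqChars d L₀ L φ a σ : Circle) : ℂ) * trPlaq ρ U a := by
  rw [trPlaq, trPlaq, plaquette_twist ι hι, map_mul, hρι, Matrix.smul_mul, one_mul, Matrix.trace_smul,
    smul_eq_mul]
  rfl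

/-- **The action under a central abelian twist** is the phased `Γ` Hamiltonian with couplings
`J_a(U)` and phases `arg tr ρ(U_a)`: `-S(ι(σ)U) = ∑_a J_a(U) Re(u_a(U) φ(σ_a))` (Grosse
(4.132)–(4.133)). [cite: Grosse1988, §4.2.4 eqs. (4.132)–(4.133)] -/
theorem minusAction_twist [NeZero L₀] [NeZero L] (hι : ∀ γ, ι γ ∈ Subgroup.center G)
    (hρι : ∀ γ, ρ (ι γ) = ((φ γ : Circle) : ℂ) • (1 : Matrix (Fin N) (Fin N) ℂ)) (JE JM : ℝ)
    (σ : Config d L₀ L Γ) (U : Config d L₀ L G) :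
    minusAction ρ JE JM (twist ι σ U) =
      phasedHamiltonian (plaqChars d L₀ L φ) (bgCpl ρ JE JM U) (bgPh ρ U) σ := by
  rw [minusAction_eq_sum, phasedHamiltonian]
  refine Finset.sum_congr rfl fun a _ => ?_
  rw [bgCpl_mul_rePhased, trPlaq_twist hι hρι, mul_comm (((plaqChars d L₀ L φ a) σ : Circle) : ℂ)]

/-- **The twisted weight is the phased Ginibre weight of the `Γ` theory** in the background `U`.
[cite: Grosse1988, §4.2.4 eq. (4.133)] -/
theorem weight_twist [NeZero L₀] [NeZero L] (hι : ∀ γ, ι γ ∈ Subgroup.center G)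
    (hρι : ∀ γ, ρ (ι γ) = ((φ γ : Circle) : ℂ) • (1 : Matrix (Fin N) (Fin N) ℂ)) (JE JM : ℝ)
    (σ : Config d L₀ L Γ) (U : Config d L₀ L G) :
    weight ρ JE JM (twist ι σ U) =
      phasedGinibreWeight (plaqChars d L₀ L φ) (bgCpl ρ JE JM U) (bgPh ρ U) σ := by
  rw [weight, phasedGinibreWeight, minusAction_twist hι hρι]

variable (φ)

/-- The weight of the `Γ` theory in the representation `charRep φ` is Ginibre's weight with the
constant couplings `(J_E, J_M)`. [cite: Ginibre1970, §2 Example 4 with Model 3 (plane rotators and their subgroups)] -/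
theorem weight_charRep [NeZero L₀] [NeZero L] (JE JM : ℝ) (σ : Config d L₀ L Γ) :
    weight (charRep φ) JE JM σ = ginibreWeight (plaqChars d L₀ L φ) (cpl JE JM) σ := by
  rw [weight, ginibreWeight, minusAction_eq_sum, ginibreHamiltonian]
  refine congrArg Real.exp (Finset.sum_congr rfl fun a _ => ?_)
  rw [trPlaq, trace_charRep_re, reChar]
  rfl

end Background

/-! ### §4 The `Γ` theory as a Ginibre model; Griffiths' inequalities for its characters -/

section GammaTheory

variable [NeZero L₀] [NeZero L] {Γ : Type*} [CommGroup Γ] [TopologicalSpace Γ] [IsTopologicalGroup Γ]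
  [CompactSpace Γ] [SecondCountableTopology Γ] [MeasurableSpace Γ] [BorelSpace Γ] (φ : Γ →ₜ* Circle)

omit [NeZero L₀] [NeZero L] [TopologicalSpace Γ] [IsTopologicalGroup Γ] [CompactSpace Γ] [SecondCountableTopology Γ]
  [MeasurableSpace Γ] [BorelSpace Γ] in
/-- If every element of `Γ` is a square, so is every configuration. [folklore] -/
private theorem surjective_mul_self_cfg (hΓ : Function.Surjective fun γ : Γ => γ * γ) :
    Function.Surjective fun ψ : Config d L₀ L Γ => ψ * ψ := fun θ =>
  ⟨fun e => Classical.choose (hΓ (θ e)), funext fun e => Classical.choose_spec (hΓ (θ e))⟩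

omit [SecondCountableTopology Γ] in
/-- **Every finite-temperature expectation of the `Γ` theory in the representation `charRep φ` is a
Ginibre expectation** with the constant couplings `(J_E, J_M)`. [cite: Ginibre1970, §2 Example 4 with Model 3 (plane rotators and their subgroups)] -/
theorem expectation_charRep_eq_ginibreExpect (JE JM : ℝ) (f : Config d L₀ L Γ → ℝ) :
    expectation (charRep φ) JE JM f =
      ginibreExpect (haar d L₀ L Γ) (plaqChars d L₀ L φ) (cpl JE JM) f := by
  unfold expectation ginibreExpect
  simp_rw [weight_charRep]

omit [SecondCountableTopology Γ] in
/-- **The abelian Polyakov two-point function is the Ginibre expectation of `Re χ_x`.**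
[cite: BorgsSeiler1983, §II.3 (II.22) (p. 337)] -/
theorem polyakovCorrelation_charRep_eq (JE JM : ℝ) (x : Fin d → ZMod L) :
    polyakovCorrelation (L₀ := L₀) (charRep φ) JE JM x =
      expectation (charRep φ) JE JM (reChar (pairChar (L₀ := L₀) φ x)) := by
  unfold polyakovCorrelation
  congr 1
  funext σ
  exact (reChar_pairChar φ x σ).symm

/-- **Griffiths' first inequality for characters of the finite-temperature `Γ` theory**:
`0 ≤ ⟨Re χ₀⟩_{Γ,charRep φ,J_E,J_M}` for `J_E, J_M ≥ 0`, when every element of `Γ` is a square.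
[cite: Ginibre1970, Prop. 3 with §2 Example 4 and Model 3 (Griffiths' first inequality)] -/
theorem expectation_charRep_reChar_nonneg (hΓ : Function.Surjective fun γ : Γ => γ * γ) {JE JM : ℝ}
    (hJE : 0 ≤ JE) (hJM : 0 ≤ JM) (χ₀ : Config d L₀ L Γ →ₜ* Circle) :
    0 ≤ expectation (charRep φ) JE JM (reChar χ₀) := by
  haveI : (haar d L₀ L Γ).IsHaarMeasure := by unfold haar; infer_instance
  rw [expectation_charRep_eq_ginibreExpect]
  have h := abs_phasedGinibreExpect_rePhased_le (haar d L₀ L Γ) (surjective_mul_self_cfg hΓ)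
    (plaqChars d L₀ L φ) (J := cpl JE JM) (fun a => cpl_nonneg' hJE hJM a) 1 1 χ₀
  rw [rePhased_one, phasedGinibreExpect_one] at h
  exact (abs_nonneg _).trans h

/-- **Griffiths' second inequality in the couplings for characters of the finite-temperature `Γ`
theory**: `⟨Re χ₀⟩` is non-decreasing in `(J_E, J_M) ≥ 0` (Ginibre 1970).
[cite: Ginibre1970, main theorem with §2 Example 4 and Model 3 (plane rotators)] -/
theorem expectation_charRep_reChar_mono (hΓ : Function.Surjective fun γ : Γ => γ * γ)
    {JE JM JE' JM' : ℝ} (hJE : 0 ≤ JE) (hJM : 0 ≤ JM) (hE : JE ≤ JE') (hM : JM ≤ JM')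
    (χ₀ : Config d L₀ L Γ →ₜ* Circle) :
    expectation (charRep φ) JE JM (reChar χ₀) ≤ expectation (charRep φ) JE' JM' (reChar χ₀) := by
  haveI : (haar d L₀ L Γ).IsHaarMeasure := by unfold haar; infer_instance
  rw [expectation_charRep_eq_ginibreExpect, expectation_charRep_eq_ginibreExpect]
  refine ginibreExpect_reChar_mono _ (surjective_mul_self_cfg hΓ) _ _ (fun a => cpl_nonneg' hJE hJM a)
    fun a => ?_
  rcases a with a | a <;> simp [cpl, hE, hM]

end GammaTheory

section ZnTheory

variable [NeZero L₀] [NeZero L]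

omit [NeZero L₀] [NeZero L] in
/-- The `ℤ_n` plaquette characters are the restrictions of the `ℤ_{2n}` ones along
`ℤ_n^E ↪ ℤ_{2n}^E`. [cite: Ginibre1970, §2 Example 4 (discrete case)] -/
theorem plaqChars_znIncl_eq_compLeft (n : ℕ) (a : PlaqIdx d L₀ L)
    (σ : Config d L₀ L ↥(rootsOfUnityCircle n)) :
    plaqChars d L₀ L (znIncl n) a σ = plaqChars d L₀ L (znIncl (2 * n)) a
      (MonoidHom.compLeft (Subgroup.inclusion (rootsOfUnityCircle_le_two_mul n))
        (FiniteTemperature.Site d L₀ L × Dir d) σ) := by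
  apply Subtype.ext
  simp only [plaqChars, plaqChar_apply, znIncl_apply]
  rw [plaquette_compLeft, Subgroup.coe_inclusion]

omit [NeZero L₀] [NeZero L] in
/-- The `ℤ_n` pair character is the restriction of the `ℤ_{2n}` one. [cite: Ginibre1970, §2 Example 4 (discrete case)] -/
theorem pairChar_znIncl_eq_compLeft (n : ℕ) (x : Fin d → ZMod L)
    (σ : Config d L₀ L ↥(rootsOfUnityCircle n)) :
    pairChar (znIncl n) x σ = pairChar (znIncl (2 * n)) x
      (MonoidHom.compLeft (Subgroup.inclusion (rootsOfUnityCircle_le_two_mul n))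
        (FiniteTemperature.Site d L₀ L × Dir d) σ) := by
  apply Subtype.ext
  rw [coe_pairChar, coe_pairChar]
  simp only [znIncl_apply]
  rw [polyakovLine_compLeft, polyakovLine_compLeft, Subgroup.coe_inclusion, Subgroup.coe_inclusion]

/-- **Griffiths' first inequality for characters of the finite-temperature `ℤ_n` theory, every
`n ≥ 1`**, for characters restricted along `ℤ_n^E ↪ ℤ_{2n}^E`. [cite: Ginibre1970, Prop. 3 with §2 Example 4 (discrete case) and Model 3] -/
theorem zn_expectation_reChar_nonneg_of_neZero {n : ℕ} [NeZero n] {JE JM : ℝ} (hJE : 0 ≤ JE)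
    (hJM : 0 ≤ JM) (χ₀ : Config d L₀ L ↥(rootsOfUnityCircle n) →ₜ* Circle)
    (χt₀ : Config d L₀ L ↥(rootsOfUnityCircle (2 * n)) →ₜ* Circle)
    (hχ₀ : ∀ σ, χ₀ σ = χt₀ (MonoidHom.compLeft
      (Subgroup.inclusion (rootsOfUnityCircle_le_two_mul n)) (FiniteTemperature.Site d L₀ L × Dir d) σ)) :
    0 ≤ expectation (znRep n) JE JM (reChar χ₀) := by
  haveI : (haar d L₀ L ↥(rootsOfUnityCircle n)).IsMulLeftInvariant := by unfold haar; infer_instance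
  rw [← charRep_znIncl, expectation_charRep_eq_ginibreExpect]
  have h2 := rootsOfUnityCircle_le_two_mul n
  exact GinibreSqrtExt.ginibreExpect_reChar_nonneg_of_sqrtExt (haar d L₀ L ↥(rootsOfUnityCircle n))
    (MonoidHom.compLeft (Subgroup.inclusion h2) (FiniteTemperature.Site d L₀ L × Dir d))
    (Subgroup.inclusion_injective h2).comp_left
    (GinibreSqrtExt.exists_mul_self_eq_compLeft _ (exists_mul_self_eq_inclusion_rootsOfUnityCircle n))
    (plaqChars d L₀ L (znIncl n)) χ₀ (plaqChars d L₀ L (znIncl (2 * n))) χt₀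
    (plaqChars_znIncl_eq_compLeft n) hχ₀ (fun a => cpl_nonneg' hJE hJM a)

end ZnTheory

/-! ### §5 Haar invariance: averaging over twists -/

section Averaging

variable [NeZero L₀] [NeZero L] {G : Type*} [Group G] [TopologicalSpace G] [IsTopologicalGroup G]
  [CompactSpace G] [MeasurableSpace G] [BorelSpace G] {Γ : Type*} [CommGroup Γ] (ι : Γ →* G)

/-- The twist by `σ` as a measurable automorphism of the configuration space. [cite: Grosse1988, §4.2.4 eq. (4.131)] -/
def twistEquiv (σ : Config d L₀ L Γ) : Config d L₀ L G ≃ᵐ Config d L₀ L G where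
  toFun := twist ι σ
  invFun := twist ι σ⁻¹
  left_inv := twist_inv_twist ι σ
  right_inv := twist_twist_inv ι σ
  measurable_toFun := measurable_pi_lambda _ fun e => (measurable_pi_apply e).const_mul _
  measurable_invFun := measurable_pi_lambda _ fun e => (measurable_pi_apply e).const_mul _

/-- **The twist preserves the a-priori measure** (link by link a left translation of Haar measure)
— the invariance `dg_b = d(γ_b g_b)` behind Grosse (4.131). [cite: Grosse1988, §4.2.4 eq. (4.131)] -/
theorem measurePreserving_twist (σ : Config d L₀ L Γ) :
    MeasurePreserving (twistEquiv (d := d) (L₀ := L₀) (L := L) ι σ) (haar d L₀ L G) (haar d L₀ L G) := by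
  unfold haar
  exact measurePreserving_pi (f := fun (e : FiniteTemperature.Site d L₀ L × Dir d) (g : G) => ι (σ e) * g)
    (fun _ => haarProbability G) (fun _ => haarProbability G)
    fun e => measurePreserving_mul_left (haarProbability G) (ι (σ e))

variable [SecondCountableTopology G] [TopologicalSpace Γ] [IsTopologicalGroup Γ] [CompactSpace Γ]
  [SecondCountableTopology Γ] [MeasurableSpace Γ] [BorelSpace Γ]

omit [NeZero L₀] [NeZero L] [CompactSpace G] [MeasurableSpace G] [BorelSpace G] [SecondCountableTopology G]
  [IsTopologicalGroup Γ] [CompactSpace Γ] [SecondCountableTopology Γ] [MeasurableSpace Γ] [BorelSpace Γ] in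
/-- The twist is jointly continuous in `(U, σ)` for continuous `ι`. [folklore] -/
private theorem continuous_twist_pair (hιc : Continuous ι) :
    Continuous fun p : Config d L₀ L G × Config d L₀ L Γ => twist ι p.2 p.1 :=
  continuous_pi fun e =>
    (hιc.comp ((continuous_apply e).comp continuous_snd)).mul ((continuous_apply e).comp continuous_fst)

/-- **Averaged Haar invariance** (Grosse (4.131)): for continuous `g` and `ι`,
`∫ g(U) dU = ∫ dU ∫_{Γ^E} dσ g(ι(σ)U)`. [cite: Grosse1988, §4.2.4 eq. (4.131)] -/
theorem integral_eq_integral_integral_twist (hιc : Continuous ι) {g : Config d L₀ L G → ℝ}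
    (hg : Continuous g) :
    ∫ U, g U ∂haar d L₀ L G = ∫ U, (∫ σ, g (twist ι σ U) ∂haar d L₀ L Γ) ∂haar d L₀ L G := by
  set F : Config d L₀ L G × Config d L₀ L Γ → ℝ := fun p => g (twist ι p.2 p.1) with hF
  have hFc : Continuous F := hg.comp (continuous_twist_pair ι hιc)
  have hFi : Integrable F ((haar d L₀ L G).prod (haar d L₀ L Γ)) :=
    integrable_of_continuous_compactSpace _ hFc
  have h1 : ∫ U, (∫ σ, g (twist ι σ U) ∂haar d L₀ L Γ) ∂haar d L₀ L G =
      ∫ p, F p ∂((haar d L₀ L G).prod (haar d L₀ L Γ)) := (integral_prod F hFi).symm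
  have h2 : ∫ p, F p ∂((haar d L₀ L G).prod (haar d L₀ L Γ)) =
      ∫ σ, (∫ U, g (twist ι σ U) ∂haar d L₀ L G) ∂haar d L₀ L Γ := integral_prod_symm F hFi
  have h3 : ∀ σ, ∫ U, g (twist ι σ U) ∂haar d L₀ L G = ∫ U, g U ∂haar d L₀ L G := fun σ =>
    (measurePreserving_twist ι σ).integral_comp' (f := twistEquiv ι σ) g
  rw [h1, h2]
  simp_rw [h3]
  rw [integral_const, smul_eq_mul, probReal_univ, one_mul]

/-- Integrability of the inner `σ`-averages as functions of the background. [folklore] -/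
private theorem integrable_integral_twist (hιc : Continuous ι) {g : Config d L₀ L G → ℝ}
    (hg : Continuous g) :
    Integrable (fun U => ∫ σ, g (twist ι σ U) ∂haar d L₀ L Γ) (haar d L₀ L G) := by
  set F : Config d L₀ L G × Config d L₀ L Γ → ℝ := fun p => g (twist ι p.2 p.1) with hF
  have hFc : Continuous F := hg.comp (continuous_twist_pair ι hιc)
  have hFi : Integrable F ((haar d L₀ L G).prod (haar d L₀ L Γ)) :=
    integrable_of_continuous_compactSpace _ hFc
  exact hFi.integral_prod_left

/-! ### §6 The abstract comparison theorem on `ℤ_{L₀} × (ℤ/L)^d` -/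

variable (ρ : G →* Matrix (Fin N) (Fin N) ℂ)

/-- The analytic core with the abelian correlation inequality abstracted: a twist-covariant
observable `X(ι(σ)U) = M⁻¹ Re(t(U) χ₀(σ))`, `‖t‖ ≤ M`, and a `Γ`-model obeying the
MMP/Ginibre bound for `χ₀` with couplings `≤ (N J_E, N J_M)` give
`|∫ X e^{-S}| ≤ ⟨Re χ₀⟩_{N J_E, N J_M} ∫ e^{-S}`. [folklore] -/
private theorem abs_integral_mul_le_core (φ : Γ →ₜ* Circle) (hρ : Continuous ρ)
    (hρu : ∀ g, ρ g ∈ Matrix.unitaryGroup (Fin N) ℂ) (hιc : Continuous ι)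
    (hι : ∀ γ, ι γ ∈ Subgroup.center G)
    (hρι : ∀ γ, ρ (ι γ) = ((φ γ : Circle) : ℂ) • (1 : Matrix (Fin N) (Fin N) ℂ)) {JE JM : ℝ}
    (hJE : 0 ≤ JE) (hJM : 0 ≤ JM) {X : Config d L₀ L G → ℝ} (hXc : Continuous X) {M : ℝ} (hM : 0 ≤ M)
    {t : Config d L₀ L G → ℂ} (ht : ∀ U, ‖t U‖ ≤ M) (χ₀ : Config d L₀ L Γ →ₜ* Circle)
    (hX : ∀ σ U, X (twist ι σ U) = M⁻¹ * (t U * ((χ₀ σ : Circle) : ℂ)).re)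
    (hineq : ∀ (J : PlaqIdx d L₀ L → ℝ), (∀ a, 0 ≤ J a) → (∀ a, J a ≤ cpl ((N : ℝ) * JE) ((N : ℝ) * JM) a) →
      ∀ (u : PlaqIdx d L₀ L → Circle) (w : ℂ),
        |phasedGinibreExpect (haar d L₀ L Γ) (plaqChars d L₀ L φ) J u
            (fun σ => (w * ((χ₀ σ : Circle) : ℂ)).re)| ≤
          ‖w‖ * ginibreExpect (haar d L₀ L Γ) (plaqChars d L₀ L φ)
            (cpl ((N : ℝ) * JE) ((N : ℝ) * JM)) (reChar χ₀))
    (hc0 : 0 ≤ ginibreExpect (haar d L₀ L Γ) (plaqChars d L₀ L φ)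
      (cpl ((N : ℝ) * JE) ((N : ℝ) * JM)) (reChar χ₀)) :
    |∫ U, X U * weight ρ JE JM U ∂haar d L₀ L G| ≤
      ginibreExpect (haar d L₀ L Γ) (plaqChars d L₀ L φ) (cpl ((N : ℝ) * JE) ((N : ℝ) * JM))
        (reChar χ₀) * ∫ U, weight ρ JE JM U ∂haar d L₀ L G := by
  haveI : (haar d L₀ L Γ).IsHaarMeasure := by unfold haar; infer_instance
  set πΓ : Measure (Config d L₀ L Γ) := haar d L₀ L Γ with hπΓ
  set χ := plaqChars d L₀ L φ with hχ
  set c : ℝ := ginibreExpect πΓ χ (cpl ((N : ℝ) * JE) ((N : ℝ) * JM)) (reChar χ₀) with hc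
  set w : Config d L₀ L G → ℝ := fun U => weight ρ JE JM U with hw
  change |∫ U, X U * w U ∂haar d L₀ L G| ≤ c * ∫ U, w U ∂haar d L₀ L G
  -- continuity of the integrands
  have hwc : Continuous w := continuous_weight ρ hρ JE JM
  have hXwc : Continuous fun U => X U * w U := hXc.mul hwc
  -- averaged Haar invariance for the numerator and the partition function (Grosse (4.131))
  rw [integral_eq_integral_integral_twist ι hιc hXwc, integral_eq_integral_integral_twist ι hιc hwc,
    ← integral_const_mul]
  -- the background system (Grosse (4.132)–(4.133))
  set J : Config d L₀ L G → PlaqIdx d L₀ L → ℝ := bgCpl ρ JE JM with hJ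
  set u : Config d L₀ L G → PlaqIdx d L₀ L → Circle := bgPh ρ with hu
  set Z : Config d L₀ L G → ℝ := fun U => ∫ σ, phasedGinibreWeight χ (J U) (u U) σ ∂πΓ with hZ
  have hZU : ∀ U, 0 < Z U := fun U => integral_phasedGinibreWeight_pos πΓ χ (J U) (u U)
  have hw_tw : ∀ U σ, w (twist ι σ U) = phasedGinibreWeight χ (J U) (u U) σ := fun U σ =>
    weight_twist hι hρι JE JM σ U
  have hinnerB : ∀ U, ∫ σ, w (twist ι σ U) ∂πΓ = Z U := fun U => by simp_rw [hw_tw]; rfl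
  have hinnerA : ∀ U, ∫ σ, X (twist ι σ U) * w (twist ι σ U) ∂πΓ =
      M⁻¹ * (phasedGinibreExpect πΓ χ (J U) (u U) (fun σ => (t U * ((χ₀ σ : Circle) : ℂ)).re) * Z U) := by
    intro U
    have e : ∀ σ, X (twist ι σ U) * w (twist ι σ U) =
        M⁻¹ * ((t U * ((χ₀ σ : Circle) : ℂ)).re * phasedGinibreWeight χ (J U) (u U) σ) :=
      fun σ => by rw [hX, hw_tw]; ring
    simp_rw [e]
    rw [integral_const_mul, phasedGinibreExpect, div_mul_cancel₀ _ (hZU U).ne']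
  -- the pointwise bound (MMP + Ginibre), uniformly in the background
  have hpt : ∀ U, |∫ σ, X (twist ι σ U) * w (twist ι σ U) ∂πΓ| ≤ c * ∫ σ, w (twist ι σ U) ∂πΓ := by
    intro U
    rw [hinnerA, hinnerB]
    have hE := hineq (J U) (fun a => bgCpl_nonneg ρ hJE hJM U a) (fun a => bgCpl_le ρ hρu hJE hJM U a)
      (u U) (t U)
    have hMM : M⁻¹ * M ≤ 1 := by
      rcases hM.eq_or_lt with h | h
      · rw [← h]; simp
      · rw [inv_mul_cancel₀ h.ne']
    have hZ0 := hZU U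
    rw [abs_mul, abs_mul, abs_of_nonneg (inv_nonneg.2 hM), abs_of_pos hZ0]
    calc M⁻¹ * (|phasedGinibreExpect πΓ χ (J U) (u U) (fun σ => (t U * ((χ₀ σ : Circle) : ℂ)).re)| * Z U)
        ≤ M⁻¹ * ((‖t U‖ * c) * Z U) := by gcongr
      _ ≤ M⁻¹ * ((M * c) * Z U) := by gcongr; exact ht U
      _ = (M⁻¹ * M) * (c * Z U) := by ring
      _ ≤ 1 * (c * Z U) := by gcongr
      _ = c * Z U := one_mul _
  -- integrate the pointwise bound
  have hintB := (integrable_integral_twist ι hιc hwc).const_mul c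
  refine (abs_integral_le_integral_abs).trans
    (integral_mono_of_nonneg (ae_of_all _ fun U => abs_nonneg _) hintB (ae_of_all _ fun U => hpt U))

/-- **ABELIAN-CENTRE DOMINATION OF TWIST-COVARIANT OBSERVABLES AT FINITE TEMPERATURE** (Fröhlich
1979; Grosse 1988 (4.131)–(4.134) on the lattice `ℤ_{L₀} × (ℤ/L)^d` of Borgs–Seiler with Wilson's
couplings `(J_E, J_M)`). `G` compact second countable, `ρ` continuous with unitary values on `ℂ^N`,
`Γ` compact second-countable abelian with every element a square, `φ : Γ → U(1)` a continuous
character, `ι : Γ → Z(G)` continuous with `ρ(ι(γ)) = φ(γ)·1`, `J_E, J_M ≥ 0`. If `X` is continuous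
and twist-covariant through a character `χ₀` of `Γ^E`, `X(ι(σ)U) = M⁻¹ Re(t(U) χ₀(σ))` with
`‖t(U)‖ ≤ M`, then `|⟨X⟩_{G,ρ,J_E,J_M}| ≤ ⟨Re χ₀⟩_{Γ, charRep φ, N J_E, N J_M}`.
[cite: Grosse1988, §4.2.4 eq. (4.134)] [cite: Frohlich1979ZN, title theorem] -/
theorem abs_expectation_le_of_twist (hΓ : Function.Surjective fun γ : Γ => γ * γ) (φ : Γ →ₜ* Circle)
    (hρ : Continuous ρ) (hρu : ∀ g, ρ g ∈ Matrix.unitaryGroup (Fin N) ℂ) (hιc : Continuous ι)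
    (hι : ∀ γ, ι γ ∈ Subgroup.center G)
    (hρι : ∀ γ, ρ (ι γ) = ((φ γ : Circle) : ℂ) • (1 : Matrix (Fin N) (Fin N) ℂ)) {JE JM : ℝ}
    (hJE : 0 ≤ JE) (hJM : 0 ≤ JM) {X : Config d L₀ L G → ℝ} (hXc : Continuous X) {M : ℝ} (hM : 0 ≤ M)
    {t : Config d L₀ L G → ℂ} (ht : ∀ U, ‖t U‖ ≤ M) (χ₀ : Config d L₀ L Γ →ₜ* Circle)
    (hX : ∀ σ U, X (twist ι σ U) = M⁻¹ * (t U * ((χ₀ σ : Circle) : ℂ)).re) :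
    |expectation ρ JE JM X| ≤ expectation (charRep φ) ((N : ℝ) * JE) ((N : ℝ) * JM) (reChar χ₀) := by
  haveI : (haar d L₀ L Γ).IsHaarMeasure := by unfold haar; infer_instance
  have hNE : 0 ≤ (N : ℝ) * JE := by positivity
  have hNM : 0 ≤ (N : ℝ) * JM := by positivity
  have hc0 := expectation_charRep_reChar_nonneg (d := d) (L₀ := L₀) (L := L) φ hΓ hNE hNM χ₀
  rw [expectation_charRep_eq_ginibreExpect] at hc0 ⊢
  have hZpos := partitionFunction_pos (d := d) (L₀ := L₀) (L := L) ρ hρ JE JM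
  rw [expectation, abs_div, abs_of_pos hZpos, div_le_iff₀ hZpos]
  refine abs_integral_mul_le_core ι ρ φ hρ hρu hιc hι hρι hJE hJM hXc hM ht χ₀ hX ?_ hc0
  intro J hJ0 hJle u w
  exact abs_phasedGinibreExpect_re_mul_le_of_le _ (surjective_mul_self_cfg hΓ) _ hJ0 hJle u w χ₀

end Averaging

section CoreZn

variable [NeZero L₀] [NeZero L] {G : Type*} [Group G] [TopologicalSpace G] [IsTopologicalGroup G]
  [CompactSpace G] [MeasurableSpace G] [BorelSpace G] [SecondCountableTopology G]
  (ρ : G →* Matrix (Fin N) (Fin N) ℂ)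

/-- **`ℤ_n`-CENTRE DOMINATION OF TWIST-COVARIANT OBSERVABLES AT FINITE TEMPERATURE, EVERY
`n ≥ 1`** (Fröhlich 1979; Grosse 1988 (4.134)): as `abs_expectation_le_of_twist` with `Γ = ℤ_n`,
`ι : ℤ_n → Z(G)`, `ρ(ι(z)) = z·1`, the correlation inequalities supplied through `ℤ_n^E ↪ ℤ_{2n}^E`
for a character `χ₀` restricted from `ℤ_{2n}^E`:
`|⟨X⟩_{G,ρ,J_E,J_M}| ≤ ⟨Re χ₀⟩_{ℤ_n, N J_E, N J_M}`. [cite: Grosse1988, §4.2.4 eq. (4.134)] [cite: Frohlich1979ZN, title theorem] -/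
theorem abs_expectation_le_of_twist_zn {n : ℕ} [NeZero n] (ι : ↥(rootsOfUnityCircle n) →* G)
    (hρ : Continuous ρ) (hρu : ∀ g, ρ g ∈ Matrix.unitaryGroup (Fin N) ℂ)
    (hι : ∀ z, ι z ∈ Subgroup.center G)
    (hρι : ∀ z, ρ (ι z) = (((z : Circle) : ℂ)) • (1 : Matrix (Fin N) (Fin N) ℂ)) {JE JM : ℝ}
    (hJE : 0 ≤ JE) (hJM : 0 ≤ JM) {X : Config d L₀ L G → ℝ} (hXc : Continuous X) {M : ℝ} (hM : 0 ≤ M)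
    {t : Config d L₀ L G → ℂ} (ht : ∀ U, ‖t U‖ ≤ M)
    (χ₀ : Config d L₀ L ↥(rootsOfUnityCircle n) →ₜ* Circle)
    (χt₀ : Config d L₀ L ↥(rootsOfUnityCircle (2 * n)) →ₜ* Circle)
    (hχ₀ : ∀ σ, χ₀ σ = χt₀ (MonoidHom.compLeft
      (Subgroup.inclusion (rootsOfUnityCircle_le_two_mul n)) (FiniteTemperature.Site d L₀ L × Dir d) σ))
    (hX : ∀ σ U, X (twist ι σ U) = M⁻¹ * (t U * ((χ₀ σ : Circle) : ℂ)).re) :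
    |expectation ρ JE JM X| ≤ expectation (znRep n) ((N : ℝ) * JE) ((N : ℝ) * JM) (reChar χ₀) := by
  haveI : (haar d L₀ L ↥(rootsOfUnityCircle n)).IsMulLeftInvariant := by unfold haar; infer_instance
  have hιc : Continuous ι := continuous_of_discreteTopology
  have hρι' : ∀ z, ρ (ι z) = ((znIncl n z : Circle) : ℂ) • (1 : Matrix (Fin N) (Fin N) ℂ) := hρι
  have hNE : 0 ≤ (N : ℝ) * JE := by positivity
  have hNM : 0 ≤ (N : ℝ) * JM := by positivity
  have hc0 := zn_expectation_reChar_nonneg_of_neZero (d := d) (L₀ := L₀) (L := L) hNE hNM χ₀ χt₀ hχ₀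
  rw [← charRep_znIncl, expectation_charRep_eq_ginibreExpect] at hc0 ⊢
  have hZpos := partitionFunction_pos (d := d) (L₀ := L₀) (L := L) ρ hρ JE JM
  rw [expectation, abs_div, abs_of_pos hZpos, div_le_iff₀ hZpos]
  have h2 := rootsOfUnityCircle_le_two_mul n
  refine abs_integral_mul_le_core ι ρ (znIncl n) hρ hρu hιc hι hρι' hJE hJM hXc hM ht χ₀ hX ?_ hc0
  intro J hJ0 hJle u w
  exact GinibreSqrtExt.abs_phasedGinibreExpect_re_mul_le_of_le_of_sqrtExt _
    (MonoidHom.compLeft (Subgroup.inclusion h2) (FiniteTemperature.Site d L₀ L × Dir d))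
    (Subgroup.inclusion_injective h2).comp_left
    (GinibreSqrtExt.exists_mul_self_eq_compLeft _ (exists_mul_self_eq_inclusion_rootsOfUnityCircle n))
    (plaqChars d L₀ L (znIncl n)) (plaqChars d L₀ L (znIncl (2 * n)))
    (plaqChars_znIncl_eq_compLeft n) hJ0 hJle u w χ₀ χt₀ hχ₀

end CoreZn

/-! ### §7 The Polyakov-pair observable; domination of `G_L(x)` and of the complex kernel -/

section Pair

variable [NeZero L₀] [NeZero L] {G : Type*} [Group G] [TopologicalSpace G] [IsTopologicalGroup G]
  [CompactSpace G] [MeasurableSpace G] [BorelSpace G] [SecondCountableTopology G]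
  (ρ : G →* Matrix (Fin N) (Fin N) ℂ)

omit [TopologicalSpace G] [IsTopologicalGroup G] [CompactSpace G] [MeasurableSpace G] [BorelSpace G]
  [SecondCountableTopology G] in
/-- The **phased Polyakov-pair observable** `X_c(U) = Re(c · χ(g_{L_0}) χ̄(g_{L_x})) / N²` (for
`c = 1`: Borgs–Seiler's integrand of `G_L(x)` ((II.22)) normalised by `N²`). [cite: BorgsSeiler1983, §II.3 (II.22) (p. 337)] -/
def pairObs (x : Fin d → ZMod L) (c : ℂ) (U : Config d L₀ L G) : ℝ :=
  (c * (polyakovTrace ρ U 0 * conj (polyakovTrace ρ U x))).re / (N : ℝ) ^ 2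

omit [NeZero L₀] [NeZero L] [CompactSpace G] [MeasurableSpace G] [BorelSpace G] [SecondCountableTopology G] in
/-- The phased pair observable is continuous. [folklore] -/
private theorem continuous_pairObs (hρ : Continuous ρ) (x : Fin d → ZMod L) (c : ℂ) :
    Continuous (pairObs (d := d) (L₀ := L₀) (L := L) ρ x c) :=
  (Complex.continuous_re.comp (continuous_const.mul ((continuous_polyakovTrace ρ hρ 0).mul
    (Complex.continuous_conj.comp (continuous_polyakovTrace ρ hρ x))))).div_const _

omit [NeZero L₀] [NeZero L] [TopologicalSpace G] [IsTopologicalGroup G] [CompactSpace G] [MeasurableSpace G]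
  [BorelSpace G] [SecondCountableTopology G] in
/-- `‖c · χ(g_{L_0}) χ̄(g_{L_x})‖ ≤ N²` for unitary `ρ` and `‖c‖ ≤ 1`. [cite: BorgsSeiler1983, §II.3 (II.22) (p. 337)] -/
private theorem norm_phased_pair_le (hρu : ∀ g, ρ g ∈ Matrix.unitaryGroup (Fin N) ℂ)
    (x : Fin d → ZMod L) {c : ℂ} (hc : ‖c‖ ≤ 1) (U : Config d L₀ L G) :
    ‖c * (polyakovTrace ρ U 0 * conj (polyakovTrace ρ U x))‖ ≤ (N : ℝ) ^ 2 := by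
  have h1 : ‖polyakovTrace ρ U 0‖ ≤ N := FiniteTemperature.norm_trace_le_of_mem_unitaryGroup (hρu _)
  have h2 : ‖polyakovTrace ρ U x‖ ≤ N := FiniteTemperature.norm_trace_le_of_mem_unitaryGroup (hρu _)
  rw [norm_mul, norm_mul, Complex.norm_conj]
  calc ‖c‖ * (‖polyakovTrace ρ U 0‖ * ‖polyakovTrace ρ U x‖) ≤ 1 * ((N : ℝ) * N) :=
        mul_le_mul hc (mul_le_mul h1 h2 (norm_nonneg _) (Nat.cast_nonneg N))
          (mul_nonneg (norm_nonneg _) (norm_nonneg _)) zero_le_one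
    _ = (N : ℝ) ^ 2 := by ring

variable {Γ : Type*} [CommGroup Γ] {ι : Γ →* G} [TopologicalSpace Γ] [IsTopologicalGroup Γ]
  {φ : Γ →ₜ* Circle} {ρ}

omit [NeZero L₀] [NeZero L] [TopologicalSpace G] [IsTopologicalGroup G] [CompactSpace G] [MeasurableSpace G]
  [BorelSpace G] [SecondCountableTopology G] in
/-- **Twist covariance of the Polyakov pair** (Grosse (4.133) for both Polyakov loops):
`X_c(ι(σ)U) = (N²)⁻¹ Re( c χ(g_{L_0}(U)) χ̄(g_{L_x}(U)) · χ_x(σ) )`. [cite: Grosse1988, §4.2.4 eq. (4.133)] -/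
theorem pairObs_twist (hι : ∀ γ, ι γ ∈ Subgroup.center G)
    (hρι : ∀ γ, ρ (ι γ) = ((φ γ : Circle) : ℂ) • (1 : Matrix (Fin N) (Fin N) ℂ))
    (x : Fin d → ZMod L) (c : ℂ) (σ : Config d L₀ L Γ) (U : Config d L₀ L G) :
    pairObs ρ x c (twist ι σ U) =
      ((N : ℝ) ^ 2)⁻¹ * ((c * (polyakovTrace ρ U 0 * conj (polyakovTrace ρ U x))) *
        ((pairChar φ x σ : Circle) : ℂ)).re := by
  rw [pairObs, polyakovTrace_twist hι hρι, polyakovTrace_twist hι hρι, map_mul (starRingEnd ℂ),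
    coe_pairChar, div_eq_inv_mul]
  set a : ℂ := ((φ (polyakovLine σ 0) : Circle) : ℂ)
  set b : ℂ := ((φ (polyakovLine σ x) : Circle) : ℂ)
  set t₁ : ℂ := polyakovTrace ρ U 0
  set t₂ : ℂ := polyakovTrace ρ U x
  have h : c * (a * t₁ * (conj b * conj t₂)) = c * (t₁ * conj t₂) * (a * conj b) := by ring
  rw [h]

variable (ρ ι)
variable [CompactSpace Γ] [SecondCountableTopology Γ] [MeasurableSpace Γ] [BorelSpace Γ]

/-- **Abelian-centre domination of the phased Polyakov pair at finite temperature**: for `‖c‖ ≤ 1`,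
`|⟨Re(c χ(g_{L_0}) χ̄(g_{L_x}))/N²⟩_{G,ρ,J_E,J_M}| ≤ ⟨Re χ_x⟩_{Γ, charRep φ, N J_E, N J_M}`.
[cite: Grosse1988, §4.2.4 eqs. (4.133)–(4.134)] -/
theorem abs_expectation_pairObs_le_abelianCentre (hΓ : Function.Surjective fun γ : Γ => γ * γ) (φ : Γ →ₜ* Circle)
    (hρ : Continuous ρ) (hρu : ∀ g, ρ g ∈ Matrix.unitaryGroup (Fin N) ℂ) (hιc : Continuous ι)
    (hι : ∀ γ, ι γ ∈ Subgroup.center G)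
    (hρι : ∀ γ, ρ (ι γ) = ((φ γ : Circle) : ℂ) • (1 : Matrix (Fin N) (Fin N) ℂ)) {JE JM : ℝ}
    (hJE : 0 ≤ JE) (hJM : 0 ≤ JM) (x : Fin d → ZMod L) {c : ℂ} (hc : ‖c‖ ≤ 1) :
    |expectation ρ JE JM (pairObs (L₀ := L₀) ρ x c)| ≤
      expectation (charRep φ) ((N : ℝ) * JE) ((N : ℝ) * JM) (reChar (pairChar (L₀ := L₀) φ x)) :=
  abs_expectation_le_of_twist ι ρ hΓ φ hρ hρu hιc hι hρι hJE hJM (continuous_pairObs ρ hρ x c)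
    (M := (N : ℝ) ^ 2) (by positivity)
    (t := fun U => c * (polyakovTrace ρ U 0 * conj (polyakovTrace ρ U x)))
    (fun U => norm_phased_pair_le ρ hρu x hc U) (pairChar φ x) (fun σ U => pairObs_twist hι hρι x c σ U)

variable {ρ ι} in
omit [SecondCountableTopology G] in
/-- `G_L(x) = N² · ⟨X_1⟩` (the two-point function is `N²` times the expectation of the normalised
pair observable with `c = 1`; both sides vanish for `N = 0`). [cite: BorgsSeiler1983, §II.3 (II.22) (p. 337)] -/
private theorem polyakovCorrelation_eq_mul_expectation_pairObs (JE JM : ℝ) (x : Fin d → ZMod L) :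
    polyakovCorrelation (L₀ := L₀) ρ JE JM x =
      (N : ℝ) ^ 2 * expectation ρ JE JM (pairObs (L₀ := L₀) ρ x 1) := by
  unfold polyakovCorrelation expectation
  rcases Nat.eq_zero_or_pos N with hN | hN
  · subst hN
    have h0 : ∀ U : Config d L₀ L G, (polyakovTrace ρ U 0 * conj (polyakovTrace ρ U x)).re = 0 :=
      fun U => by simp [polyakovTrace, Matrix.trace]
    simp_rw [h0]
    simp
  · have hN2 : ((N : ℝ)) ^ 2 ≠ 0 := by positivity
    have e : ∀ U : Config d L₀ L G, pairObs ρ x 1 U * weight ρ JE JM U =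
        ((polyakovTrace ρ U 0 * conj (polyakovTrace ρ U x)).re * weight ρ JE JM U) / (N : ℝ) ^ 2 :=
      fun U => by rw [pairObs, one_mul]; ring
    simp_rw [e]
    rw [integral_div, div_div, ← mul_div_assoc, mul_div_mul_left _ _ hN2]

/-- ★ **ABELIAN-CENTRE DOMINATION OF THE FINITE-TEMPERATURE POLYAKOV TWO-POINT FUNCTION**
(Fröhlich 1979 / Grosse 1988 (4.133)–(4.134) on Borgs–Seiler's lattice `ℤ_{L₀} × (ℤ/L)^d`). `G`
compact second countable, `ρ : G →* M_N(ℂ)` continuous with unitary values, `Γ` compact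
second-countable abelian with every element a square (`U(1)`; `ℤ_n`, `n` odd), `φ : Γ → U(1)` a
continuous character, `ι : Γ → Z(G)` continuous with `ρ(ι(γ)) = φ(γ)·1`, `J_E, J_M ≥ 0`, every
temporal extent `L₀`, spatial box `L` and site `x`:
`|G_L^{G,ρ}(x; J_E, J_M)| ≤ N² · G_L^{Γ, charRep φ}(x; N J_E, N J_M)` — the static quark–antiquark
correlator at temperature `1/L₀` is dominated by that of the abelian centre theory at the `N`-fold
couplings. HONEST LABEL: finite-volume lattice expectations; content where the `Γ` theory confines
(strong coupling). [cite: Grosse1988, §4.2.4 eqs. (4.133)–(4.134)] [cite: BorgsSeiler1983, §II.3 (II.22)–(II.23) (p. 337)] -/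
theorem abs_polyakovCorrelation_le_abelianCentre (hΓ : Function.Surjective fun γ : Γ => γ * γ) (φ : Γ →ₜ* Circle)
    (hρ : Continuous ρ) (hρu : ∀ g, ρ g ∈ Matrix.unitaryGroup (Fin N) ℂ) (hιc : Continuous ι)
    (hι : ∀ γ, ι γ ∈ Subgroup.center G)
    (hρι : ∀ γ, ρ (ι γ) = ((φ γ : Circle) : ℂ) • (1 : Matrix (Fin N) (Fin N) ℂ)) {JE JM : ℝ}
    (hJE : 0 ≤ JE) (hJM : 0 ≤ JM) (x : Fin d → ZMod L) :
    |polyakovCorrelation (L₀ := L₀) ρ JE JM x| ≤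
      (N : ℝ) ^ 2 * polyakovCorrelation (L₀ := L₀) (charRep φ) ((N : ℝ) * JE) ((N : ℝ) * JM) x := by
  rw [polyakovCorrelation_eq_mul_expectation_pairObs, polyakovCorrelation_charRep_eq, abs_mul,
    abs_of_nonneg (by positivity : (0 : ℝ) ≤ (N : ℝ) ^ 2)]
  exact mul_le_mul_of_nonneg_left
    (abs_expectation_pairObs_le_abelianCentre ρ ι hΓ φ hρ hρu hιc hι hρι hJE hJM x (c := 1) (by simp)) (by positivity)

/-- **Any larger abelian couplings**: `|G_L^{G,ρ}(x; J_E, J_M)| ≤ N² · G_L^{Γ}(x; J_E', J_M')` for all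
`J_E' ≥ N J_E`, `J_M' ≥ N J_M` (Griffiths' second inequality in the couplings for the `Γ` correlator).
[cite: Grosse1988, §4.2.4 eq. (4.134)] [cite: Ginibre1970, main theorem with §2 Example 4 and Model 3] -/
theorem abs_polyakovCorrelation_le_abelianCentre_of_le (hΓ : Function.Surjective fun γ : Γ => γ * γ)
    (φ : Γ →ₜ* Circle) (hρ : Continuous ρ) (hρu : ∀ g, ρ g ∈ Matrix.unitaryGroup (Fin N) ℂ)
    (hιc : Continuous ι) (hι : ∀ γ, ι γ ∈ Subgroup.center G)
    (hρι : ∀ γ, ρ (ι γ) = ((φ γ : Circle) : ℂ) • (1 : Matrix (Fin N) (Fin N) ℂ)) {JE JM JE' JM' : ℝ}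
    (hJE : 0 ≤ JE) (hJM : 0 ≤ JM) (hE : (N : ℝ) * JE ≤ JE') (hM : (N : ℝ) * JM ≤ JM')
    (x : Fin d → ZMod L) :
    |polyakovCorrelation (L₀ := L₀) ρ JE JM x| ≤
      (N : ℝ) ^ 2 * polyakovCorrelation (L₀ := L₀) (charRep φ) JE' JM' x := by
  refine (abs_polyakovCorrelation_le_abelianCentre ρ ι hΓ φ hρ hρu hιc hι hρι hJE hJM x).trans ?_
  rw [polyakovCorrelation_charRep_eq, polyakovCorrelation_charRep_eq]
  exact mul_le_mul_of_nonneg_left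
    (expectation_charRep_reChar_mono φ hΓ (by positivity) (by positivity) hE hM _) (by positivity)

/-- **The optimal phase**: if `Re(cE) ≤ B` for every `‖c‖ ≤ 1` then `‖E‖ ≤ B`. [folklore] -/
private theorem norm_le_of_forall_re_mul_le' {E : ℂ} {B : ℝ} (h : ∀ c : ℂ, ‖c‖ ≤ 1 → (c * E).re ≤ B) :
    ‖E‖ ≤ B := by
  by_cases hE0 : E = 0
  · have h0 := h 0 (by simp)
    rw [hE0, norm_zero]
    simpa using h0
  · have hEn : 0 < ‖E‖ := norm_pos_iff.2 hE0
    have hc1 : ‖conj E / (‖E‖ : ℂ)‖ ≤ 1 := by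
      rw [norm_div, Complex.norm_conj, Complex.norm_real, Real.norm_eq_abs, abs_of_pos hEn,
        div_self hEn.ne']
    have hre : (conj E / (‖E‖ : ℂ) * E).re = ‖E‖ := by
      rw [div_mul_eq_mul_div, Complex.conj_mul' E]
      rw [show ((‖E‖ : ℂ) ^ 2 / (‖E‖ : ℂ)) = (‖E‖ : ℂ) by
        rw [sq, mul_div_assoc, div_self (Complex.ofReal_ne_zero.2 hEn.ne'), mul_one]]
      exact Complex.ofReal_re _
    have h1 := h _ hc1
    rwa [hre] at h1

variable {ρ ι} in
/-- `⟨X_c⟩ = Re(c · K_L(0, x))/N²` (the complex kernel `K` of the barrier companion file).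
[cite: BorgsSeiler1983, §II.3 (II.22) (p. 337)] -/
private theorem expectation_pairObs_eq_re_kernel (hρ : Continuous ρ) (JE JM : ℝ)
    (x : Fin d → ZMod L) (c : ℂ) :
    expectation ρ JE JM (pairObs (L₀ := L₀) ρ x c) =
      (c * polyakovKernel (L₀ := L₀) ρ JE JM 0 x).re / (N : ℝ) ^ 2 := by
  unfold expectation polyakovKernel
  rw [← mul_div_assoc, Complex.div_ofReal_re, div_right_comm]
  congr 1
  have hint := (integrable_polyakovKernel_integrand (L₀ := L₀) ρ hρ JE JM 0 x).const_mul c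
  have h := integral_re hint
  simp only [RCLike.re_to_complex] at h
  have e : ∀ U : Config d L₀ L G, pairObs ρ x c U * weight ρ JE JM U =
      (c * (polyakovTrace ρ U 0 * conj (polyakovTrace ρ U x) * (weight ρ JE JM U : ℂ))).re /
        (N : ℝ) ^ 2 := fun U => by
    rw [pairObs]
    simp only [Complex.mul_re, Complex.mul_im, Complex.ofReal_re, Complex.ofReal_im, mul_zero,
      sub_zero]
    ring
  simp_rw [e]
  rw [integral_div, h, integral_const_mul]

/-- **Complex-kernel form**: `‖K_L^{G,ρ}(0, x; J_E, J_M)‖ ≤ N² · G_L^{Γ, charRep φ}(x; N J_E, N J_M)` —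
the bound holds for the modulus of Borgs–Seiler's complex two-point kernel
`K(0,x) = ⟨χ(g_{L_0}) χ̄(g_{L_x})⟩`, not only for its real part `G_L(x)` (optimal phase).
[cite: Grosse1988, §4.2.4 eqs. (4.133)–(4.134)] [cite: BorgsSeiler1983, §II.3 (II.22) (p. 337)] -/
theorem norm_polyakovKernel_le_abelianCentre (hΓ : Function.Surjective fun γ : Γ => γ * γ) (φ : Γ →ₜ* Circle)
    (hρ : Continuous ρ) (hρu : ∀ g, ρ g ∈ Matrix.unitaryGroup (Fin N) ℂ) (hιc : Continuous ι)
    (hι : ∀ γ, ι γ ∈ Subgroup.center G)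
    (hρι : ∀ γ, ρ (ι γ) = ((φ γ : Circle) : ℂ) • (1 : Matrix (Fin N) (Fin N) ℂ)) {JE JM : ℝ}
    (hJE : 0 ≤ JE) (hJM : 0 ≤ JM) (x : Fin d → ZMod L) :
    ‖polyakovKernel (L₀ := L₀) ρ JE JM 0 x‖ ≤
      (N : ℝ) ^ 2 * polyakovCorrelation (L₀ := L₀) (charRep φ) ((N : ℝ) * JE) ((N : ℝ) * JM) x := by
  rw [polyakovCorrelation_charRep_eq]
  set W := expectation (charRep φ) ((N : ℝ) * JE) ((N : ℝ) * JM) (reChar (pairChar (L₀ := L₀) φ x))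
  set E := polyakovKernel (L₀ := L₀) ρ JE JM 0 x with hE
  rcases Nat.eq_zero_or_pos N with hN | hN
  · subst hN
    have h0 : E = 0 := by
      rw [hE, polyakovKernel]
      have : (fun U : Config d L₀ L G => polyakovTrace ρ U 0 * conj (polyakovTrace ρ U x) *
          (weight ρ JE JM U : ℂ)) = fun _ => 0 := by
        funext U; simp [polyakovTrace, Matrix.trace]
      rw [this, integral_zero, zero_div]
    rw [h0, norm_zero]
    simp
  · have hN2 : (0 : ℝ) < ((N : ℕ) : ℝ) ^ 2 := by positivity
    refine norm_le_of_forall_re_mul_le' fun c hc => ?_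
    have h := abs_expectation_pairObs_le_abelianCentre (d := d) (L₀ := L₀) ρ ι hΓ φ hρ hρu hιc hι hρι hJE hJM x hc
    rw [expectation_pairObs_eq_re_kernel hρ, ← hE] at h
    have h' := (le_abs_self _).trans h
    exact ((div_le_iff₀ hN2).1 h').trans_eq (mul_comm _ _)

end Pair

section PairZn

variable [NeZero L₀] [NeZero L] {G : Type*} [Group G] [TopologicalSpace G] [IsTopologicalGroup G]
  [CompactSpace G] [MeasurableSpace G] [BorelSpace G] [SecondCountableTopology G]
  (ρ : G →* Matrix (Fin N) (Fin N) ℂ)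

/-- **`ℤ_n`-centre domination of the phased Polyakov pair at finite temperature, every `n ≥ 1`**.
[cite: Grosse1988, §4.2.4 eqs. (4.133)–(4.134)] -/
theorem abs_expectation_pairObs_le_zn_of_neZero {n : ℕ} [NeZero n]
    (ι : ↥(rootsOfUnityCircle n) →* G) (hρ : Continuous ρ)
    (hρu : ∀ g, ρ g ∈ Matrix.unitaryGroup (Fin N) ℂ) (hι : ∀ z, ι z ∈ Subgroup.center G)
    (hρι : ∀ z, ρ (ι z) = (((z : Circle) : ℂ)) • (1 : Matrix (Fin N) (Fin N) ℂ)) {JE JM : ℝ}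
    (hJE : 0 ≤ JE) (hJM : 0 ≤ JM) (x : Fin d → ZMod L) {c : ℂ} (hc : ‖c‖ ≤ 1) :
    |expectation ρ JE JM (pairObs (L₀ := L₀) ρ x c)| ≤
      expectation (znRep n) ((N : ℝ) * JE) ((N : ℝ) * JM) (reChar (pairChar (L₀ := L₀) (znIncl n) x)) :=
  have hρι' : ∀ z, ρ (ι z) = ((znIncl n z : Circle) : ℂ) • (1 : Matrix (Fin N) (Fin N) ℂ) := hρι
  abs_expectation_le_of_twist_zn ρ ι hρ hρu hι hρι hJE hJM (continuous_pairObs ρ hρ x c)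
    (M := (N : ℝ) ^ 2) (by positivity)
    (t := fun U => c * (polyakovTrace ρ U 0 * conj (polyakovTrace ρ U x)))
    (fun U => norm_phased_pair_le ρ hρu x hc U) (pairChar (znIncl n) x) (pairChar (znIncl (2 * n)) x)
    (pairChar_znIncl_eq_compLeft n x) (fun σ U => pairObs_twist hι hρι' x c σ U)

/-- ★ **`ℤ_n`-CENTRE DOMINATION OF THE FINITE-TEMPERATURE POLYAKOV TWO-POINT FUNCTION, EVERY
`n ≥ 1`** (Fröhlich 1979, title theorem with `ℤ_n`; Grosse 1988 (4.133)–(4.134)): compact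
second-countable `G`, continuous unitary `ρ` on `ℂ^N`, `ι : ℤ_n → Z(G)` with `ρ(ι(z)) = z·1`,
`J_E, J_M ≥ 0`: `|G_L^{G,ρ}(x; J_E, J_M)| ≤ N² · G_L^{ℤ_n}(x; N J_E, N J_M)`.
[cite: Grosse1988, §4.2.4 eqs. (4.133)–(4.134)] [cite: BorgsSeiler1983, §II.3 (II.22)–(II.23) (p. 337)] -/
theorem abs_polyakovCorrelation_le_zn_of_neZero {n : ℕ} [NeZero n]
    (ι : ↥(rootsOfUnityCircle n) →* G) (hρ : Continuous ρ)
    (hρu : ∀ g, ρ g ∈ Matrix.unitaryGroup (Fin N) ℂ) (hι : ∀ z, ι z ∈ Subgroup.center G)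
    (hρι : ∀ z, ρ (ι z) = (((z : Circle) : ℂ)) • (1 : Matrix (Fin N) (Fin N) ℂ)) {JE JM : ℝ}
    (hJE : 0 ≤ JE) (hJM : 0 ≤ JM) (x : Fin d → ZMod L) :
    |polyakovCorrelation (L₀ := L₀) ρ JE JM x| ≤
      (N : ℝ) ^ 2 * polyakovCorrelation (L₀ := L₀) (znRep n) ((N : ℝ) * JE) ((N : ℝ) * JM) x := by
  rw [polyakovCorrelation_eq_mul_expectation_pairObs, ← charRep_znIncl, polyakovCorrelation_charRep_eq,
    abs_mul, abs_of_nonneg (by positivity : (0 : ℝ) ≤ (N : ℝ) ^ 2)]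
  exact mul_le_mul_of_nonneg_left
    (abs_expectation_pairObs_le_zn_of_neZero ρ ι hρ hρu hι hρι hJE hJM x (c := 1) (by simp))
    (by positivity)

end PairZn

/-! ### §8 Transfer of Polyakov's criterion along a finite-volume domination -/

section Transfer

variable [NeZero L₀] {G : Type*} [Group G] [TopologicalSpace G] [IsTopologicalGroup G]
  [CompactSpace G] [MeasurableSpace G] [BorelSpace G] [SecondCountableTopology G]
  {ρ : G →* Matrix (Fin N) (Fin N) ℂ}
  {N' : ℕ} {G' : Type*} [Group G'] [TopologicalSpace G'] [IsTopologicalGroup G']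
  [CompactSpace G'] [MeasurableSpace G'] [BorelSpace G'] [SecondCountableTopology G']
  {ρ' : G' →* Matrix (Fin N') (Fin N') ℂ}

omit [SecondCountableTopology G] [NeZero L₀] in
/-- A further subsequence along which the (bounded) two-point functions of a second theory converge
pointwise (diagonal argument in `[-N'², N'²]^{ℤ^d}`). [folklore] -/
private theorem exists_tendsto_subseq [NeZero L₀] (hρ' : Continuous ρ')
    (hρ'u : ∀ g, ρ' g ∈ Matrix.unitaryGroup (Fin N') ℂ) (JE' JM' : ℝ) (φ : ℕ → ℕ) :
    ∃ (ψ : ℕ → ℕ) (G₂ : (Fin d → ℤ) → ℝ), StrictMono ψ ∧ ∀ x : Fin d → ℤ,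
      Tendsto (fun k => polyakovCorrelation (L₀ := L₀) (L := 2 * φ (ψ k) + 2) ρ' JE' JM'
        (fun i => ((x i : ℤ) : ZMod (2 * φ (ψ k) + 2)))) atTop (𝓝 (G₂ x)) := by
  set u : ℕ → (Fin d → ℤ) → ℝ := fun k x =>
    polyakovCorrelation (L₀ := L₀) (L := 2 * φ k + 2) ρ' JE' JM' (fun i => ((x i : ℤ) : ZMod (2 * φ k + 2)))
    with hu
  set S : Set ((Fin d → ℤ) → ℝ) := Set.pi Set.univ fun _ => Set.Icc (-(N' : ℝ) ^ 2) ((N' : ℝ) ^ 2)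
  have hS : IsCompact S := isCompact_univ_pi fun _ => isCompact_Icc
  have hmem : ∀ k, u k ∈ S := fun k => by
    simp only [S, Set.mem_pi, Set.mem_univ, true_implies, Set.mem_Icc]
    intro x
    exact abs_le.1 (FiniteTemperature.abs_polyakovCorrelation_le ρ' hρ' hρ'u JE' JM' _)
  obtain ⟨a, -, ψ, hψ, hlim⟩ := hS.tendsto_subseq hmem
  refine ⟨ψ, a, hψ, fun x => ?_⟩
  have := tendsto_pi_nhds.1 hlim x
  simpa [hu, Function.comp_def] using this

omit [SecondCountableTopology G'] in
/-- **Long-range order goes DOWN along a domination** (Polyakov's criterion (II.23)): if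
`|G_L^{ρ}(x; J_E, J_M)| ≤ C · G_L^{ρ'}(x; J_E', J_M')` in every even periodic box, then Polyakov
long-range order of `ρ` at `(J_E, J_M)` implies Polyakov long-range order of `ρ'` at `(J_E', J_M')`
(every thermodynamic limit of `ρ'` dominates, along a sub-subsequence, a thermodynamic limit of `ρ`).
[cite: BorgsSeiler1983, §II.3 (II.23) (p. 337)] -/
theorem hasPolyakovLongRangeOrder_of_dominated (hρ : Continuous ρ)
    (hρu : ∀ g, ρ g ∈ Matrix.unitaryGroup (Fin N) ℂ) {JE JM JE' JM' C : ℝ}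
    (hdom : ∀ (L : ℕ) [NeZero L] (x : Fin d → ZMod L),
      |polyakovCorrelation (L₀ := L₀) ρ JE JM x| ≤ C * polyakovCorrelation (L₀ := L₀) ρ' JE' JM' x)
    (h : HasPolyakovLongRangeOrder d L₀ ρ JE JM) : HasPolyakovLongRangeOrder d L₀ ρ' JE' JM' := by
  intro G₂ hG₂ hzero
  obtain ⟨φ, hφ, hlim₂⟩ := hG₂
  obtain ⟨ψ, G₁, hψ, hlim₁⟩ := exists_tendsto_subseq (d := d) (L₀ := L₀) hρ hρu JE JM φ
  have hTDL : IsThermodynamicLimit (d := d) (L₀ := L₀) ρ JE JM G₁ := ⟨φ ∘ ψ, hφ.comp hψ, hlim₁⟩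
  refine h G₁ hTDL ?_
  have hpt : ∀ x, |G₁ x| ≤ C * G₂ x := fun x =>
    le_of_tendsto_of_tendsto' ((continuous_abs.tendsto _).comp (hlim₁ x))
      (((hlim₂ x).comp hψ.tendsto_atTop).const_mul C) fun k => hdom _ _
  refine squeeze_zero_norm (fun x => ?_) (by simpa using hzero.const_mul C)
  rw [Real.norm_eq_abs]; exact hpt x

omit [SecondCountableTopology G] in
/-- **Confinement at all couplings goes UP along a domination**: if for all `J_E, J_M > 0` and every
even box `|G_L^{ρ}(x; J_E, J_M)| ≤ C · G_L^{ρ'}(x; s J_E, s J_M)` with `s > 0`, then Polyakov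
confinement of `ρ'` at all couplings implies Polyakov confinement of `ρ` at all couplings (same
temporal extent). [cite: BorgsSeiler1983, §II.3 (II.23) (p. 337)] -/
theorem polyakovConfinementAtAllCouplings_of_dominated (hρ' : Continuous ρ')
    (hρ'u : ∀ g, ρ' g ∈ Matrix.unitaryGroup (Fin N') ℂ) {C s : ℝ} (hs : 0 < s)
    (hdom : ∀ (JE JM : ℝ), 0 < JE → 0 < JM → ∀ (L : ℕ) [NeZero L] (x : Fin d → ZMod L),
      |polyakovCorrelation (L₀ := L₀) ρ JE JM x| ≤
        C * polyakovCorrelation (L₀ := L₀) ρ' (s * JE) (s * JM) x)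
    (h : PolyakovConfinementAtAllCouplings d L₀ ρ') : PolyakovConfinementAtAllCouplings d L₀ ρ := by
  intro JE JM hJE hJM G₁ hG₁
  obtain ⟨φ, hφ, hlim₁⟩ := hG₁
  obtain ⟨ψ, G₂, hψ, hlim₂⟩ :=
    exists_tendsto_subseq (d := d) (L₀ := L₀) hρ' hρ'u (s * JE) (s * JM) φ
  have hTDL : IsThermodynamicLimit (d := d) (L₀ := L₀) ρ' (s * JE) (s * JM) G₂ :=
    ⟨φ ∘ ψ, hφ.comp hψ, hlim₂⟩
  have hzero := h (s * JE) (s * JM) (mul_pos hs hJE) (mul_pos hs hJM) G₂ hTDL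
  have hpt : ∀ x, |G₁ x| ≤ C * G₂ x := fun x =>
    le_of_tendsto_of_tendsto' ((continuous_abs.tendsto _).comp ((hlim₁ x).comp hψ.tendsto_atTop))
      ((hlim₂ x).const_mul C) fun k => hdom JE JM hJE hJM _ _
  refine squeeze_zero_norm (fun x => ?_) (by simpa using hzero.const_mul C)
  rw [Real.norm_eq_abs]; exact hpt x

omit [TopologicalSpace G] [IsTopologicalGroup G] [CompactSpace G] [MeasurableSpace G] [BorelSpace G]
  [SecondCountableTopology G] [TopologicalSpace G'] [IsTopologicalGroup G'] [CompactSpace G']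
  [MeasurableSpace G'] [BorelSpace G'] [SecondCountableTopology G'] in
/-- **Volume-uniform exponential clustering goes UP along a domination** (finite-volume form; no
limits needed). [cite: BorgsSeiler1983, §II.3 (II.23) (p. 337); §II.4 (II.55)–(II.56) (p. 343)] -/
theorem uniformClusteringAtAllCouplings_of_dominated
    [TopologicalSpace G] [IsTopologicalGroup G] [CompactSpace G] [MeasurableSpace G] [BorelSpace G]
    [TopologicalSpace G'] [IsTopologicalGroup G'] [CompactSpace G'] [MeasurableSpace G'] [BorelSpace G']
    {C s : ℝ} (hC : 0 ≤ C) (hs : 0 < s)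
    (hdom : ∀ (JE JM : ℝ), 0 < JE → 0 < JM → ∀ (L : ℕ) [NeZero L] (x : Fin d → ZMod L),
      |polyakovCorrelation (L₀ := L₀) ρ JE JM x| ≤
        C * polyakovCorrelation (L₀ := L₀) ρ' (s * JE) (s * JM) x)
    (h : UniformClusteringAtAllCouplings d L₀ ρ') : UniformClusteringAtAllCouplings d L₀ ρ := by
  intro JE JM hJE hJM
  obtain ⟨C', m, hm, hB⟩ := h (s * JE) (s * JM) (mul_pos hs hJE) (mul_pos hs hJM)
  refine ⟨C * C', m, hm, fun k x hx => ?_⟩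
  calc |polyakovCorrelation (L₀ := L₀) (L := 2 * k + 2) ρ JE JM (fun i => ((x i : ℤ) : ZMod (2 * k + 2)))|
      ≤ C * polyakovCorrelation (L₀ := L₀) ρ' (s * JE) (s * JM) (fun i => ((x i : ℤ) : ZMod (2 * k + 2))) :=
        hdom JE JM hJE hJM _ _
    _ ≤ C * (C' * Real.exp (-m * ‖x‖)) :=
        mul_le_mul_of_nonneg_left ((le_abs_self _).trans (hB k x hx)) hC
    _ = C * C' * Real.exp (-m * ‖x‖) := by ring

end Transfer

/-! ### §9 Centre instances of the transfers -/

section CentreTransfer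

variable [NeZero L₀] {G : Type*} [Group G] [TopologicalSpace G] [IsTopologicalGroup G]
  [CompactSpace G] [MeasurableSpace G] [BorelSpace G] [SecondCountableTopology G]
  (ρ : G →* Matrix (Fin N) (Fin N) ℂ)
  {Γ : Type*} [CommGroup Γ] (ι : Γ →* G) [TopologicalSpace Γ] [IsTopologicalGroup Γ]
  [CompactSpace Γ] [SecondCountableTopology Γ] [MeasurableSpace Γ] [BorelSpace Γ]

/-- **Deconfinement is inherited BY the abelian centre**: Polyakov long-range order of the `G`
theory at `(J_E, J_M) ≥ 0` implies Polyakov long-range order of the `Γ` theory (representation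
`charRep φ`) at `(N J_E, N J_M)`, at the same temporal extent — the deconfined region of `G`, scaled
by `N`, lies inside that of its centre theory. [cite: Grosse1988, §4.2.4 eq. (4.134)] [cite: BorgsSeiler1983, §II.3 (II.23) (p. 337)] -/
theorem hasPolyakovLongRangeOrder_abelianCentre (hΓ : Function.Surjective fun γ : Γ => γ * γ)
    (φ : Γ →ₜ* Circle) (hρ : Continuous ρ) (hρu : ∀ g, ρ g ∈ Matrix.unitaryGroup (Fin N) ℂ)
    (hιc : Continuous ι) (hι : ∀ γ, ι γ ∈ Subgroup.center G)
    (hρι : ∀ γ, ρ (ι γ) = ((φ γ : Circle) : ℂ) • (1 : Matrix (Fin N) (Fin N) ℂ)) {JE JM : ℝ}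
    (hJE : 0 ≤ JE) (hJM : 0 ≤ JM) (h : HasPolyakovLongRangeOrder d L₀ ρ JE JM) :
    HasPolyakovLongRangeOrder d L₀ (charRep φ) ((N : ℝ) * JE) ((N : ℝ) * JM) :=
  hasPolyakovLongRangeOrder_of_dominated hρ hρu
    (fun _ _ x => abs_polyakovCorrelation_le_abelianCentre ρ ι hΓ φ hρ hρu hιc hι hρι hJE hJM x) h

/-- **Polyakov confinement at all couplings is inherited FROM the abelian centre** (`N ≥ 1`):
if the `Γ` theory (representation `charRep φ`) confines static quarks at all couplings at the temporal
extent `L₀`, so does the `G` theory. HONEST LABEL: the hypothesis fails for `U(1)`/`ℤ_n` in `d ≥ 3`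
at large `J_E` (deconfinement), so this is a statement about the structure of the criterion, with
content only where it is applied coupling by coupling (strong coupling). [cite: Grosse1988, §4.2.4 (text after eq. (4.134))] [cite: BorgsSeiler1983, §II.3 (II.23) (p. 337)] -/
theorem polyakovConfinementAtAllCouplings_of_abelianCentre [NeZero N]
    (hΓ : Function.Surjective fun γ : Γ => γ * γ) (φ : Γ →ₜ* Circle) (hρ : Continuous ρ)
    (hρu : ∀ g, ρ g ∈ Matrix.unitaryGroup (Fin N) ℂ) (hιc : Continuous ι)
    (hι : ∀ γ, ι γ ∈ Subgroup.center G)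
    (hρι : ∀ γ, ρ (ι γ) = ((φ γ : Circle) : ℂ) • (1 : Matrix (Fin N) (Fin N) ℂ))
    (h : PolyakovConfinementAtAllCouplings d L₀ (charRep φ)) :
    PolyakovConfinementAtAllCouplings d L₀ ρ :=
  polyakovConfinementAtAllCouplings_of_dominated (continuous_charRep φ) (charRep_mem_unitaryGroup φ)
    (s := (N : ℝ)) (by exact_mod_cast Nat.pos_of_ne_zero (NeZero.ne N))
    (fun JE JM hJE hJM _ _ x => abs_polyakovCorrelation_le_abelianCentre ρ ι hΓ φ hρ hρu hιc hι hρι hJE.le hJM.le x) h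

/-- **Volume-uniform exponential clustering of the Polyakov correlation at all couplings is
inherited FROM the abelian centre** (`N ≥ 1`; the finite-volume shape delivered by convergent
strong-coupling expansions, Borgs–Seiler (II.55)–(II.56)). [cite: Grosse1988, §4.2.4 (text after eq. (4.134))] [cite: BorgsSeiler1983, §II.4 (II.55)–(II.56) (p. 343)] -/
theorem uniformClusteringAtAllCouplings_of_abelianCentre [NeZero N]
    (hΓ : Function.Surjective fun γ : Γ => γ * γ) (φ : Γ →ₜ* Circle) (hρ : Continuous ρ)
    (hρu : ∀ g, ρ g ∈ Matrix.unitaryGroup (Fin N) ℂ) (hιc : Continuous ι)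
    (hι : ∀ γ, ι γ ∈ Subgroup.center G)
    (hρι : ∀ γ, ρ (ι γ) = ((φ γ : Circle) : ℂ) • (1 : Matrix (Fin N) (Fin N) ℂ))
    (h : UniformClusteringAtAllCouplings d L₀ (charRep φ)) :
    UniformClusteringAtAllCouplings d L₀ ρ :=
  uniformClusteringAtAllCouplings_of_dominated (ρ' := charRep φ) (C := (N : ℝ) ^ 2) (by positivity)
    (s := (N : ℝ)) (by exact_mod_cast Nat.pos_of_ne_zero (NeZero.ne N))
    (fun JE JM hJE hJM _ _ x => abs_polyakovCorrelation_le_abelianCentre ρ ι hΓ φ hρ hρu hιc hι hρι hJE.le hJM.le x) h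

end CentreTransfer

section CentreTransferZn

variable [NeZero L₀] {G : Type*} [Group G] [TopologicalSpace G] [IsTopologicalGroup G]
  [CompactSpace G] [MeasurableSpace G] [BorelSpace G] [SecondCountableTopology G]
  (ρ : G →* Matrix (Fin N) (Fin N) ℂ)

/-- **Deconfinement is inherited by the `ℤ_n` centre, every `n ≥ 1`**: Polyakov long-range order of
`G` at `(J_E, J_M) ≥ 0` ⇒ Polyakov long-range order of `ℤ_n` at `(N J_E, N J_M)`.
[cite: Grosse1988, §4.2.4 eq. (4.134)] [cite: BorgsSeiler1983, §II.3 (II.23) (p. 337)] -/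
theorem hasPolyakovLongRangeOrder_zn_of_neZero {n : ℕ} [NeZero n]
    (ι : ↥(rootsOfUnityCircle n) →* G) (hρ : Continuous ρ)
    (hρu : ∀ g, ρ g ∈ Matrix.unitaryGroup (Fin N) ℂ) (hι : ∀ z, ι z ∈ Subgroup.center G)
    (hρι : ∀ z, ρ (ι z) = (((z : Circle) : ℂ)) • (1 : Matrix (Fin N) (Fin N) ℂ)) {JE JM : ℝ}
    (hJE : 0 ≤ JE) (hJM : 0 ≤ JM) (h : HasPolyakovLongRangeOrder d L₀ ρ JE JM) :
    HasPolyakovLongRangeOrder d L₀ (znRep n) ((N : ℝ) * JE) ((N : ℝ) * JM) :=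
  hasPolyakovLongRangeOrder_of_dominated hρ hρu
    (fun _ _ x => abs_polyakovCorrelation_le_zn_of_neZero ρ ι hρ hρu hι hρι hJE hJM x) h

/-- **Polyakov confinement at all couplings is inherited from the `ℤ_n` centre, every `n ≥ 1`**
(`N ≥ 1`). HONEST LABEL: content at strong coupling (the `ℤ_n` theory deconfines at large `J_E` in
`d ≥ 3`, tree: `z2_finiteTemperatureDeconfinement` for `n = 2`). [cite: Grosse1988, §4.2.4 (text after eq. (4.134))] [cite: BorgsSeiler1983, §II.3 (II.23) (p. 337)] -/
theorem polyakovConfinementAtAllCouplings_of_zn_of_neZero [NeZero N] {n : ℕ} [NeZero n]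
    (ι : ↥(rootsOfUnityCircle n) →* G) (hρ : Continuous ρ)
    (hρu : ∀ g, ρ g ∈ Matrix.unitaryGroup (Fin N) ℂ) (hι : ∀ z, ι z ∈ Subgroup.center G)
    (hρι : ∀ z, ρ (ι z) = (((z : Circle) : ℂ)) • (1 : Matrix (Fin N) (Fin N) ℂ))
    (h : PolyakovConfinementAtAllCouplings d L₀ (znRep n)) : PolyakovConfinementAtAllCouplings d L₀ ρ := by
  have hc : Continuous (znRep n) := by rw [← charRep_znIncl]; exact continuous_charRep _
  have hu : ∀ z, znRep n z ∈ Matrix.unitaryGroup (Fin 1) ℂ := by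
    rw [← charRep_znIncl]; exact charRep_mem_unitaryGroup _
  exact polyakovConfinementAtAllCouplings_of_dominated hc hu (s := (N : ℝ))
    (by exact_mod_cast Nat.pos_of_ne_zero (NeZero.ne N))
    (fun JE JM hJE hJM _ _ x => abs_polyakovCorrelation_le_zn_of_neZero ρ ι hρ hρu hι hρι hJE.le hJM.le x) h

/-- **Volume-uniform clustering at all couplings is inherited from the `ℤ_n` centre, every `n ≥ 1`**
(`N ≥ 1`). [cite: Grosse1988, §4.2.4 (text after eq. (4.134))] [cite: BorgsSeiler1983, §II.4 (II.55)–(II.56) (p. 343)] -/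
theorem uniformClusteringAtAllCouplings_of_zn_of_neZero [NeZero N] {n : ℕ} [NeZero n]
    (ι : ↥(rootsOfUnityCircle n) →* G) (hρ : Continuous ρ)
    (hρu : ∀ g, ρ g ∈ Matrix.unitaryGroup (Fin N) ℂ) (hι : ∀ z, ι z ∈ Subgroup.center G)
    (hρι : ∀ z, ρ (ι z) = (((z : Circle) : ℂ)) • (1 : Matrix (Fin N) (Fin N) ℂ))
    (h : UniformClusteringAtAllCouplings d L₀ (znRep n)) : UniformClusteringAtAllCouplings d L₀ ρ :=
  uniformClusteringAtAllCouplings_of_dominated (ρ' := znRep n) (C := (N : ℝ) ^ 2) (by positivity)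
    (s := (N : ℝ)) (by exact_mod_cast Nat.pos_of_ne_zero (NeZero.ne N))
    (fun JE JM hJE hJM _ _ x => abs_polyakovCorrelation_le_zn_of_neZero ρ ι hρ hρu hι hρι hJE.le hJM.le x) h

end CentreTransferZn

end ThermalCentre

/-! ### §10 Gauge-group instances: `U(N) ⊇ U(1)`, `SU(N) ⊇ ℤ_n` (`n ∣ N`), `SU(N) ⊇ ℤ_N`, `SU(3) ⊇ ℤ_3` -/

section Unitary

open ThermalCentre

variable {d L₀ L N : ℕ} [NeZero L₀]

/-- The scalar circle `z ↦ z·1` is central in `U(N)`. [folklore] -/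
private theorem scalarUnitaryHom_mem_center'' (z : Circle) :
    (scalarUnitaryHom z : Matrix.unitaryGroup (Fin N) ℂ) ∈ Subgroup.center (Matrix.unitaryGroup (Fin N) ℂ) := by
  rw [Subgroup.mem_center_iff]
  intro g
  apply Subtype.ext
  simp only [Submonoid.coe_mul, scalarUnitaryHom_apply, coe_scalarUnitary, Matrix.mul_smul,
    Matrix.mul_one, Matrix.smul_mul, Matrix.one_mul]

/-- Every element of `U(1)` is a square. [folklore] -/
private theorem surjective_mul_self_circle'' : Function.Surjective fun ψ : Circle => ψ * ψ := fun θ =>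
  ⟨Circle.exp (Complex.arg (θ : ℂ) / 2), by
    show Circle.exp _ * Circle.exp _ = θ
    rw [← Circle.exp_add, add_halves, Circle.exp_arg]⟩

/-- ★ **`U(N) ⊇ U(1)` at finite temperature**: for the fundamental representation of `U(N)`,
`J_E, J_M ≥ 0`, every temporal extent `L₀`, box `L` and site `x`,
`|G_L^{U(N)}(x; J_E, J_M)| ≤ N² · G_L^{U(1)}(x; N J_E, N J_M)` (Fröhlich 1979; Grosse 1988 (4.134);
Chatterjee 2026 §3 for `U(N) ⊇ U(1)`). HONEST LABEL: in `d ≥ 3` the `U(1)` theory deconfines at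
large `J_E` (Borgs–Seiler Lemma III.9), where the bound is merely structural. [cite: Grosse1988, §4.2.4 eq. (4.134)] [cite: BorgsSeiler1983, §II.3 (II.22) (p. 337)] -/
theorem unitaryGroup_abs_polyakovCorrelation_le_u1 [NeZero L] {JE JM : ℝ} (hJE : 0 ≤ JE)
    (hJM : 0 ≤ JM) (x : Fin d → ZMod L) :
    |polyakovCorrelation (L₀ := L₀) (unitaryFundamentalRep (Fin N) ℂ) JE JM x| ≤
      (N : ℝ) ^ 2 * polyakovCorrelation (L₀ := L₀) u1Rep ((N : ℝ) * JE) ((N : ℝ) * JM) x := by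
  have h := ThermalCentre.abs_polyakovCorrelation_le_abelianCentre (d := d) (L₀ := L₀) (L := L)
    (unitaryFundamentalRep (Fin N) ℂ) scalarUnitaryHom surjective_mul_self_circle''
    (ContinuousMonoidHom.id Circle) (continuous_unitaryFundamentalRep (Fin N) ℂ) (fun g => g.2)
    continuous_scalarUnitaryHom scalarUnitaryHom_mem_center'' (fun _ => rfl) hJE hJM x
  rwa [charRep_id_circle] at h

/-- **`U(N)` deconfinement forces `U(1)` deconfinement at `N`-fold couplings**: Polyakov long-range
order of `U(N)` at `(J_E, J_M) ≥ 0` implies Polyakov long-range order of `U(1)` at `(N J_E, N J_M)`.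
[cite: Grosse1988, §4.2.4 eq. (4.134)] [cite: BorgsSeiler1983, §II.3 (II.23) (p. 337)] -/
theorem unitaryGroup_hasPolyakovLongRangeOrder_u1 {JE JM : ℝ} (hJE : 0 ≤ JE) (hJM : 0 ≤ JM)
    (h : HasPolyakovLongRangeOrder d L₀ (unitaryFundamentalRep (Fin N) ℂ) JE JM) :
    HasPolyakovLongRangeOrder d L₀ u1Rep ((N : ℝ) * JE) ((N : ℝ) * JM) := by
  have h' := ThermalCentre.hasPolyakovLongRangeOrder_abelianCentre (d := d) (L₀ := L₀)
    (unitaryFundamentalRep (Fin N) ℂ) scalarUnitaryHom surjective_mul_self_circle''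
    (ContinuousMonoidHom.id Circle) (continuous_unitaryFundamentalRep (Fin N) ℂ) (fun g => g.2)
    continuous_scalarUnitaryHom scalarUnitaryHom_mem_center'' (fun _ => rfl) hJE hJM h
  rwa [charRep_id_circle] at h'

/-- **`U(N)` confines at all couplings (Polyakov's criterion, temporal extent `L₀`) whenever `U(1)`
does** (`N ≥ 1`). [cite: Grosse1988, §4.2.4 (text after eq. (4.134))] [cite: BorgsSeiler1983, §II.3 (II.23) (p. 337)] -/
theorem unitaryGroup_polyakovConfinementAtAllCouplings_of_u1 [NeZero N]
    (h : PolyakovConfinementAtAllCouplings d L₀ u1Rep) :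
    PolyakovConfinementAtAllCouplings d L₀ (unitaryFundamentalRep (Fin N) ℂ) := by
  rw [← charRep_id_circle] at h
  exact ThermalCentre.polyakovConfinementAtAllCouplings_of_abelianCentre (d := d) (L₀ := L₀)
    (unitaryFundamentalRep (Fin N) ℂ) scalarUnitaryHom surjective_mul_self_circle''
    (ContinuousMonoidHom.id Circle) (continuous_unitaryFundamentalRep (Fin N) ℂ) (fun g => g.2)
    continuous_scalarUnitaryHom scalarUnitaryHom_mem_center'' (fun _ => rfl) h

/-- **`U(N)` inherits volume-uniform clustering at all couplings from `U(1)`** (`N ≥ 1`).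
[cite: Grosse1988, §4.2.4 (text after eq. (4.134))] [cite: BorgsSeiler1983, §II.4 (II.55)–(II.56) (p. 343)] -/
theorem unitaryGroup_uniformClusteringAtAllCouplings_of_u1 [NeZero N]
    (h : UniformClusteringAtAllCouplings d L₀ u1Rep) :
    UniformClusteringAtAllCouplings d L₀ (unitaryFundamentalRep (Fin N) ℂ) := by
  rw [← charRep_id_circle] at h
  exact ThermalCentre.uniformClusteringAtAllCouplings_of_abelianCentre (d := d) (L₀ := L₀)
    (unitaryFundamentalRep (Fin N) ℂ) scalarUnitaryHom surjective_mul_self_circle''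
    (ContinuousMonoidHom.id Circle) (continuous_unitaryFundamentalRep (Fin N) ℂ) (fun g => g.2)
    continuous_scalarUnitaryHom scalarUnitaryHom_mem_center'' (fun _ => rfl) h

end Unitary

section SUN

open ThermalCentre

variable {d L₀ L : ℕ} [NeZero L₀]

/-- ★ **`SU(N) ⊇ ℤ_n` at finite temperature, every `n ∣ N`, `n ≥ 1`**: for the fundamental
representation of `SU(N)`, `J_E, J_M ≥ 0`: `|G_L^{SU(N)}(x; J_E, J_M)| ≤ N² · G_L^{ℤ_n}(x; N J_E, N J_M)`.
[cite: Grosse1988, §4.2.4 eq. (4.134)] [cite: Frohlich1979ZN, title theorem] -/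
theorem specialUnitaryGroup_abs_polyakovCorrelation_le_zn_of_neZero [NeZero L] {n N : ℕ} [NeZero n]
    (hnN : n ∣ N) {JE JM : ℝ} (hJE : 0 ≤ JE) (hJM : 0 ≤ JM) (x : Fin d → ZMod L) :
    |polyakovCorrelation (L₀ := L₀) (fundamentalRep (Fin N)) JE JM x| ≤
      (N : ℝ) ^ 2 * polyakovCorrelation (L₀ := L₀) (znRep n) ((N : ℝ) * JE) ((N : ℝ) * JM) x :=
  ThermalCentre.abs_polyakovCorrelation_le_zn_of_neZero (fundamentalRep (Fin N)) (znScalarSU n N hnN)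
    (continuous_fundamentalRep (Fin N)) fundamentalRep_mem_unitaryGroup (znScalarSU_mem_center hnN)
    (fun _ => rfl) hJE hJM x

/-- ★ **The FULL centre `ℤ_N ⊂ SU(N)`, every `N ≥ 1`**:
`|G_L^{SU(N)}(x; J_E, J_M)| ≤ N² · G_L^{ℤ_N}(x; N J_E, N J_M)`. [cite: Frohlich1979ZN, title theorem] [cite: Grosse1988, §4.2.4 eq. (4.134)] -/
theorem suN_abs_polyakovCorrelation_le_zN [NeZero L] {N : ℕ} [NeZero N] {JE JM : ℝ} (hJE : 0 ≤ JE)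
    (hJM : 0 ≤ JM) (x : Fin d → ZMod L) :
    |polyakovCorrelation (L₀ := L₀) (fundamentalRep (Fin N)) JE JM x| ≤
      (N : ℝ) ^ 2 * polyakovCorrelation (L₀ := L₀) (znRep N) ((N : ℝ) * JE) ((N : ℝ) * JM) x :=
  specialUnitaryGroup_abs_polyakovCorrelation_le_zn_of_neZero (dvd_refl N) hJE hJM x

/-- ★ **`SU(3) ⊇ ℤ_3` at finite temperature** (Fröhlich's title theorem with `n = 3`, finite-temperature
reading on Borgs–Seiler's lattice): `|G_L^{SU(3)}(x; J_E, J_M)| ≤ 9 · G_L^{ℤ_3}(x; 3J_E, 3J_M)` for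
every `J_E, J_M ≥ 0`, temporal extent, box and site. [cite: Frohlich1979ZN, title theorem] [cite: Grosse1988, §4.2.4 eq. (4.134)] -/
theorem su3_abs_polyakovCorrelation_le_z3 [NeZero L] {JE JM : ℝ} (hJE : 0 ≤ JE) (hJM : 0 ≤ JM)
    (x : Fin d → ZMod L) :
    |polyakovCorrelation (L₀ := L₀) (fundamentalRep (Fin 3)) JE JM x| ≤
      9 * polyakovCorrelation (L₀ := L₀) (znRep 3) (3 * JE) (3 * JM) x := by
  have h := suN_abs_polyakovCorrelation_le_zN (d := d) (L₀ := L₀) (L := L) (N := 3) hJE hJM x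
  rw [show ((3 : ℕ) : ℝ) ^ 2 = 9 by norm_num, show ((3 : ℕ) : ℝ) * JE = 3 * JE by norm_num,
    show ((3 : ℕ) : ℝ) * JM = 3 * JM by norm_num] at h
  exact h

/-- **`SU(N)` deconfinement forces `ℤ_N` deconfinement at `N`-fold couplings** (every `N ≥ 1`).
[cite: Grosse1988, §4.2.4 eq. (4.134)] [cite: BorgsSeiler1983, §II.3 (II.23) (p. 337)] -/
theorem suN_hasPolyakovLongRangeOrder_zN {N : ℕ} [NeZero N] {JE JM : ℝ} (hJE : 0 ≤ JE) (hJM : 0 ≤ JM)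
    (h : HasPolyakovLongRangeOrder d L₀ (fundamentalRep (Fin N)) JE JM) :
    HasPolyakovLongRangeOrder d L₀ (znRep N) ((N : ℝ) * JE) ((N : ℝ) * JM) :=
  ThermalCentre.hasPolyakovLongRangeOrder_zn_of_neZero (fundamentalRep (Fin N)) (znScalarSU N N (dvd_refl N))
    (continuous_fundamentalRep (Fin N)) fundamentalRep_mem_unitaryGroup (znScalarSU_mem_center _)
    (fun _ => rfl) hJE hJM h

/-- **`SU(N)` confines at all couplings (Polyakov's criterion, temporal extent `L₀`) whenever `ℤ_N`
does** — «confinement in `ℤ_N` lattice gauge theory implies confinement [of static quarks at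
temperature `1/L₀`] in `SU(N)`» (every `N ≥ 1`). [cite: Frohlich1979ZN, title theorem] [cite: BorgsSeiler1983, §II.3 (II.23) (p. 337)] -/
theorem suN_polyakovConfinementAtAllCouplings_of_zN {N : ℕ} [NeZero N]
    (h : PolyakovConfinementAtAllCouplings d L₀ (znRep N)) :
    PolyakovConfinementAtAllCouplings d L₀ (fundamentalRep (Fin N)) :=
  ThermalCentre.polyakovConfinementAtAllCouplings_of_zn_of_neZero (fundamentalRep (Fin N))
    (znScalarSU N N (dvd_refl N)) (continuous_fundamentalRep (Fin N)) fundamentalRep_mem_unitaryGroup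
    (znScalarSU_mem_center _) (fun _ => rfl) h

/-- **`SU(N)` inherits volume-uniform clustering at all couplings from `ℤ_N`** (every `N ≥ 1`).
[cite: Frohlich1979ZN, title theorem] [cite: BorgsSeiler1983, §II.4 (II.55)–(II.56) (p. 343)] -/
theorem suN_uniformClusteringAtAllCouplings_of_zN {N : ℕ} [NeZero N]
    (h : UniformClusteringAtAllCouplings d L₀ (znRep N)) :
    UniformClusteringAtAllCouplings d L₀ (fundamentalRep (Fin N)) :=
  ThermalCentre.uniformClusteringAtAllCouplings_of_zn_of_neZero (fundamentalRep (Fin N))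
    (znScalarSU N N (dvd_refl N)) (continuous_fundamentalRep (Fin N)) fundamentalRep_mem_unitaryGroup
    (znScalarSU_mem_center _) (fun _ => rfl) h

end SUN

/-! ### §11 Griffiths' inequalities for the abelian finite-temperature two-point function
(Borgs–Seiler §IV, p. 358: «for abelian models this follows from Ginibre's inequalities») -/

namespace ThermalCentre

open Z2Thermal (PlaqIdx cpl)

section AbelianMonotone

variable {d L₀ L : ℕ} [NeZero L₀] [NeZero L] {Γ : Type*} [CommGroup Γ] [TopologicalSpace Γ]
  [IsTopologicalGroup Γ] [CompactSpace Γ] [SecondCountableTopology Γ] [MeasurableSpace Γ] [BorelSpace Γ]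
  (φ : Γ →ₜ* Circle)

/-- **Griffiths' first inequality for the abelian Polyakov two-point function**: for a compact abelian
gauge group `Γ` in which every element is a square (representation `charRep φ`) and `J_E, J_M ≥ 0`,
`0 ≤ G_L^{Γ}(x; J_E, J_M)`. [cite: Ginibre1970, Prop. 3 with §2 Example 4 and Model 3 (Griffiths' first inequality)] [cite: BorgsSeiler1983, §IV (p. 358)] -/
theorem polyakovCorrelation_charRep_nonneg (hΓ : Function.Surjective fun γ : Γ => γ * γ) {JE JM : ℝ}
    (hJE : 0 ≤ JE) (hJM : 0 ≤ JM) (x : Fin d → ZMod L) :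
    0 ≤ polyakovCorrelation (L₀ := L₀) (charRep φ) JE JM x := by
  rw [polyakovCorrelation_charRep_eq]
  exact expectation_charRep_reChar_nonneg φ hΓ hJE hJM _

/-- **Griffiths' second inequality (Ginibre) for the abelian Polyakov two-point function**: for `Γ`
with surjective squaring, `G_L^{Γ}(x; J_E, J_M)` is non-decreasing in `J_E ≥ 0` and in `J_M ≥ 0` —
Borgs–Seiler's remark «The peculiar feature of our method is that it is completely independent of
`J_M` … for abelian models this [monotonicity in `J_M`] follows from Ginibre's inequalities».
[cite: BorgsSeiler1983, §IV (p. 358)] [cite: Ginibre1970, main theorem with §2 Example 4 and Model 3] -/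
theorem polyakovCorrelation_charRep_mono (hΓ : Function.Surjective fun γ : Γ => γ * γ)
    {JE JM JE' JM' : ℝ} (hJE : 0 ≤ JE) (hJM : 0 ≤ JM) (hE : JE ≤ JE') (hM : JM ≤ JM')
    (x : Fin d → ZMod L) :
    polyakovCorrelation (L₀ := L₀) (charRep φ) JE JM x ≤
      polyakovCorrelation (L₀ := L₀) (charRep φ) JE' JM' x := by
  rw [polyakovCorrelation_charRep_eq, polyakovCorrelation_charRep_eq]
  exact expectation_charRep_reChar_mono φ hΓ hJE hJM hE hM _

end AbelianMonotone

section ZnMonotone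

variable {d L₀ L : ℕ} [NeZero L₀] [NeZero L]

/-- **Griffiths' first inequality for the `ℤ_n` Polyakov two-point function, every `n ≥ 1`**:
`0 ≤ G_L^{ℤ_n}(x; J_E, J_M)` for `J_E, J_M ≥ 0` (Ginibre's discrete case through `ℤ_n^E ↪ ℤ_{2n}^E`).
[cite: Ginibre1970, Prop. 3 with §2 Example 4 (discrete case) and Model 3] [cite: BorgsSeiler1983, §IV (p. 358)] -/
theorem zn_polyakovCorrelation_nonneg_of_neZero {n : ℕ} [NeZero n] {JE JM : ℝ} (hJE : 0 ≤ JE)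
    (hJM : 0 ≤ JM) (x : Fin d → ZMod L) :
    0 ≤ polyakovCorrelation (L₀ := L₀) (znRep n) JE JM x := by
  rw [← charRep_znIncl, polyakovCorrelation_charRep_eq, charRep_znIncl]
  exact zn_expectation_reChar_nonneg_of_neZero hJE hJM _ (pairChar (znIncl (2 * n)) x)
    (pairChar_znIncl_eq_compLeft n x)

/-- **Griffiths' second inequality (Ginibre) for the `ℤ_n` Polyakov two-point function, every
`n ≥ 1`**: `G_L^{ℤ_n}(x; J_E, J_M)` is non-decreasing in `J_E ≥ 0` and in `J_M ≥ 0`.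
[cite: BorgsSeiler1983, §IV (p. 358)] [cite: Ginibre1970, §2 Example 4 (discrete case, p. 316–317)] -/
theorem zn_polyakovCorrelation_mono_of_neZero {n : ℕ} [NeZero n] {JE JM JE' JM' : ℝ} (hJE : 0 ≤ JE)
    (hJM : 0 ≤ JM) (hE : JE ≤ JE') (hM : JM ≤ JM') (x : Fin d → ZMod L) :
    polyakovCorrelation (L₀ := L₀) (znRep n) JE JM x ≤
      polyakovCorrelation (L₀ := L₀) (znRep n) JE' JM' x := by
  haveI : (haar d L₀ L ↥(rootsOfUnityCircle n)).IsMulLeftInvariant := by unfold haar; infer_instance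
  rw [← charRep_znIncl, polyakovCorrelation_charRep_eq, polyakovCorrelation_charRep_eq,
    expectation_charRep_eq_ginibreExpect, expectation_charRep_eq_ginibreExpect]
  have h2 := rootsOfUnityCircle_le_two_mul n
  refine GinibreSqrtExt.ginibreExpect_reChar_mono_of_sqrtExt (haar d L₀ L ↥(rootsOfUnityCircle n))
    (MonoidHom.compLeft (Subgroup.inclusion h2) (FiniteTemperature.Site d L₀ L × Dir d))
    (Subgroup.inclusion_injective h2).comp_left
    (GinibreSqrtExt.exists_mul_self_eq_compLeft _ (exists_mul_self_eq_inclusion_rootsOfUnityCircle n))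
    (plaqChars d L₀ L (znIncl n)) (pairChar (znIncl n) x) (plaqChars d L₀ L (znIncl (2 * n)))
    (pairChar (znIncl (2 * n)) x) (plaqChars_znIncl_eq_compLeft n) (pairChar_znIncl_eq_compLeft n x)
    (fun a => ?_) fun a => ?_
  · rcases a with a | a <;> simp [cpl, hJE, hJM]
  · rcases a with a | a <;> simp [cpl, hE, hM]

end ZnMonotone

end ThermalCentre

section U1Monotone

variable {d L₀ L : ℕ} [NeZero L₀] [NeZero L]

/-- Every element of `U(1)` is a square. [folklore] -/
private theorem surjective_mul_self_circle''' : Function.Surjective fun ψ : Circle => ψ * ψ := fun θ =>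
  ⟨Circle.exp (Complex.arg (θ : ℂ) / 2), by
    show Circle.exp _ * Circle.exp _ = θ
    rw [← Circle.exp_add, add_halves, Circle.exp_arg]⟩

/-- **`U(1)` lattice gauge theory at finite temperature: `G_L(x; J_E, J_M) ≥ 0` and non-decreasing
in `J_E, J_M ≥ 0`** (Griffiths I/II via Ginibre; Borgs–Seiler §IV p. 358 «for abelian models this
follows from Ginibre's inequalities»), every temporal extent, box and site.
[cite: BorgsSeiler1983, §IV (p. 358)] [cite: Ginibre1970, main theorem with §2 Example 4 and Model 3 (plane rotators)] -/
theorem u1_polyakovCorrelation_mono {JE JM JE' JM' : ℝ} (hJE : 0 ≤ JE) (hJM : 0 ≤ JM) (hE : JE ≤ JE')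
    (hM : JM ≤ JM') (x : Fin d → ZMod L) :
    polyakovCorrelation (L₀ := L₀) u1Rep JE JM x ≤ polyakovCorrelation (L₀ := L₀) u1Rep JE' JM' x := by
  have h := ThermalCentre.polyakovCorrelation_charRep_mono (d := d) (L₀ := L₀) (L := L)
    (ContinuousMonoidHom.id Circle) surjective_mul_self_circle''' hJE hJM hE hM x
  rwa [charRep_id_circle] at h

/-- **`U(1)`: `0 ≤ G_L(x; J_E, J_M)`** for `J_E, J_M ≥ 0` (Griffiths' first inequality).
[cite: Ginibre1970, Prop. 3 with §2 Example 4 and Model 3 (Griffiths' first inequality)] [cite: BorgsSeiler1983, §IV (p. 358)] -/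
theorem u1_polyakovCorrelation_nonneg {JE JM : ℝ} (hJE : 0 ≤ JE) (hJM : 0 ≤ JM) (x : Fin d → ZMod L) :
    0 ≤ polyakovCorrelation (L₀ := L₀) u1Rep JE JM x := by
  have h := ThermalCentre.polyakovCorrelation_charRep_nonneg (d := d) (L₀ := L₀) (L := L)
    (ContinuousMonoidHom.id Circle) surjective_mul_self_circle''' hJE hJM x
  rwa [charRep_id_circle] at h

end U1Monotone

end Literature.MathematicalPhysics.QuantumFieldTheory

end
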